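import Literature.Analysis.FunctionSpaces.LittlewoodPaleyConvergenceProofs
import Literature.Analysis.FunctionSpaces.LittlewoodPaleyMultiplierProofs
import HarnessLib

/-!
# The finite-difference characterisation of `Ḃ^s_{p,∞}`, `0 < s < 1` (BCD Thm. 2.36)

Sibling proof file of `Literature/Analysis/FunctionSpaces/LittlewoodPaley.lean` (blocks
`Literature.lpBlock = Δ̇_j`, cut-offs `Literature.lowFreqCutoff = Ṡ_j`, `L^p` norms of distributions
`Literature.Analysis.FunctionSpaces.eLpNormDistrib`, the homogeneous Besov norm `Literature.Analysis.FunctionSpaces.eHomBesovNorm` and class `Literature.Analysis.FunctionSpaces.MemHomBesov`)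
and of `Literature/Analysis/FunctionSpaces/BesovDifference.lean` (the difference seminorm
`Literature.eBesovSupSeminorm s p f μ = sup_{h ≠ 0} ‖f(· + h) - f‖_{L^p} / ‖h‖^s` and the class
`Literature.Analysis.FunctionSpaces.MemBesovSup`). It settles the named fact `Literature.Analysis.FunctionSpaces.memHomBesov_iff_memBesovSup` of
`LittlewoodPaley.lean` — Bahouri–Chemin–Danchin 2011, **Theorem 2.36** (for `s ∈ (0,1)`,
`p, r ∈ [1, ∞]`:
`C⁻¹ ‖u‖_{Ḃ^s_{p,r}} ≤ ‖ ‖τ_{-y} u - u‖_{L^p} / |y|^s ‖_{L^r(dy/|y|^d)} ≤ C ‖u‖_{Ḃ^s_{p,r}}`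
for `u ∈ 𝓢'_h`), case `r = ∞`, in the form vendored by the tree: for `f ∈ L^p`, `1 ≤ p < ∞`,
`f ∈ Ḃ^s_{p,∞}` (finite norm **and** the realisation condition `Ṡ_j f → 0`, `j → -∞`) iff
`sup_{h ≠ 0} ‖f(· + h) - f‖_{L^p} / ‖h‖^s < ∞`.

## Main results (everything here is proved)

* `Literature.memHomBesov_iff_memBesovSup_holds : memHomBesov_iff_memBesovSup` **at every `E` of
  positive dimension** (section instance `[Nontrivial E]`), assembled from the two inequalities
  `Literature.Analysis.FunctionSpaces.eHomBesovNorm_top_coe_le_eBesovSupSeminorm` (`‖f‖_{Ḃ^s_{p,∞}} ≤ C [f]_{B^s_{p,∞}}`,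
  `1 ≤ p < ∞`, any `s ≥ 0`) and `Literature.Analysis.FunctionSpaces.exists_eBesovSupSeminorm_coe_le_eHomBesovNorm`
  (`[f]_{B^s_{p,∞}} ≤ C ‖f‖_{Ḃ^s_{p,∞}}` for `f ∈ L^p ∩ 𝓢'_h`, `1 ≤ p ≤ ∞`, `0 < s < 1`), and from
  `Literature.Analysis.FunctionSpaces.tendsto_lowFreqCutoff_coe_atBot` (**`L^p ⊂ 𝓢'_h` for finite `p`** and `dim E ≥ 1`:
  `Ṡ_j f → 0` in `𝓢'` as `j → -∞`; BCD Def. 1.26 and the Examples after it).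
* **Erratum.** The named fact is a `Prop` family indexed by its implicit `E`, `F`; the source works
  on `ℝ^d`, `d ≥ 1`, and in dimension `0` the family is **false**:
  `Literature.Analysis.FunctionSpaces.not_memHomBesov_iff_memBesovSup` (`E = {0}`, `F ≠ {0}`: there `Ṡ_j = id` on `𝓢'`, so a
  nonzero constant — an `L¹` function for the unit point mass `volume` — violates the realisation
  condition, while its difference seminorm is `0`), concretely
  `Literature.Analysis.FunctionSpaces.not_memHomBesov_iff_memBesovSup_euclideanSpace_fin_zero` (`E = EuclideanSpace ℝ (Fin 0)`,
  `F = ℂ`). The closed, corrected named fact `Literature.Analysis.FunctionSpaces.memHomBesov_iff_memBesovSup_of_nontrivial`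
  restores the standing hypothesis as a leading binder `∀ [Nontrivial E]` (the pattern of
  `Literature.Analysis.FunctionSpaces.MemBesovSup.mono_exponent_of_boundedSpace` in `BesovDifference.lean`) and is discharged
  (`Literature.Analysis.FunctionSpaces.memHomBesov_iff_memBesovSup_of_nontrivial_holds`).

## The proof (BCD, proof of Theorem 2.36, with two substitutions noted below)

* (`§ TranslationMultiplier`) Translation is the Fourier multiplier `τ_h = e_h(D)`,
  `e_h(ξ) = e^{2πi⟨ξ,h⟩}` (`Literature.Analysis.FunctionSpaces.translSymbol`): for `g ∈ L^p`, `e_h(D) g = g(· + h)`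
  (`Literature.Analysis.FunctionSpaces.fourierMultiplierCLM_translSymbol_coe`; Schwartz level: modulation becomes translation,
  `𝓕(e_h θ) = (𝓕θ)(· - h)`), hence `‖e_h(D) u‖_{L^p} ≤ ‖u‖_{L^p}` on `𝓢'` and
  `(e_h - 1)(D) g = g(· + h) - g`.
* (`§ DifferenceFromBlocks`, the second inequality of Thm. 2.36) For `f ∈ L^p ∩ 𝓢'_h` the difference
  `u = (e_h - 1)(D) f` is again in `𝓢'_h`, so `‖u‖_{L^p} ≤ ∑_j ‖Δ̇_j u‖_{L^p}`
  (`Literature.Analysis.FunctionSpaces.eLpNormDistrib_le_tsum_lpBlock` of `LittlewoodPaleyConvergenceProofs.lean`), and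
  `Δ̇_j u = (e_h - 1)(D) Δ̇_j f`. High frequencies: `‖(e_h - 1)(D) w‖_{L^p} ≤ 2‖w‖_{L^p}`. Low
  frequencies (`2π 2^j ‖h‖ ≤ 1`): BCD write `τ_{-y} Δ̇_j u - Δ̇_j u = ∫₀¹ y·∇Δ̇_j u(· + ty) dt` and use
  Bernstein; here, equivalently, the block multiplier lemma
  `Literature.Analysis.FunctionSpaces.exists_eLpNormDistrib_fourierMultiplierCLM_lpBlock_le` (BCD Lemma 2.2 form, from
  `LittlewoodPaleyMultiplierProofs.lean`) is applied to the symbol `e_h - 1`, whose rescaled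
  derivatives on the annulus are `≤ 4 · 2π 2^j ‖h‖` (`|e^{iθ} - 1| ≤ |θ|`, `|Dⁿ e^{2πit}| = (2π)ⁿ`),
  giving `‖(e_h - 1)(D) Δ̇_j f‖_{L^p} ≤ C 2^j ‖h‖ ‖Δ̇_j f‖_{L^p}`. Summing `min(C 2^j‖h‖, 2) 2^{-js}`
  over `j ∈ ℤ` (`Literature.Analysis.FunctionSpaces.exists_tsum_min_mul_rpow_neg_le`, two geometric tails; this is where
  `0 < s < 1` enters) gives `‖f(· + h) - f‖_{L^p} ≤ C ‖h‖^s ‖f‖_{Ḃ^s_{p,∞}}`.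
* (`§ DyadicKernel`, `§ BlockScaling`, the first inequality) `Δ̇₀ v = k₀ ⋆ v` with the Schwartz kernel
  `k₀ = 𝓕⁻¹φ₀` of **mean zero** (`∫ k₀ = φ₀(0) = 0`), so `(k₀ ⋆ v)(x) = ∫ k₀(t)(v(x - t) - v(x)) dt`
  and — BCD use Minkowski's integral inequality; here Hölder's inequality against the finite measure
  `|k₀(t)| dt` and Tonelli, which gives the same scaling —
  `‖k₀ ⋆ v‖^p_{L^p} ≤ ‖k₀‖₁^{p-1} [v]^p_{B^s_{p,∞}} ∫ |k₀(t)| ‖t‖^{sp} dt`, i.e.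
  `‖Δ̇₀ v‖_{L^p} ≤ C [v]_{B^s_{p,∞}}` (`Literature.Analysis.FunctionSpaces.eLpNormDistrib_lpBlock_zero_coe_le`, `1 ≤ p < ∞`); the
  dyadic scaling `Δ̇_j f = (Δ̇₀ f(2^{-j}·))(2^j ·)` (`LittlewoodPaleyProofs.lean`) and
  `[f(a ·)]_{B^s_{p,∞}} ≤ a^s |a^d|^{-1/p} [f]_{B^s_{p,∞}}` give
  `2^{js} ‖Δ̇_j f‖_{L^p} ≤ C [f]_{B^s_{p,∞}}` for all `j`.
* (`§ LowFreqKernel`) `Ṡ₀ g = κ₀ ⋆ g`, `κ₀ = 𝓕⁻¹χ`, so `|⟨Ṡ₀ g, ψ⟩| ≤ ‖ψ‖_{L¹} ‖κ₀‖_{L^{p'}} ‖g‖_{L^p}`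
  (Hölder), and by scaling `|⟨Ṡ_j f, φ⟩| ≤ ‖φ‖_{L¹} ‖κ₀‖_{L^{p'}} 2^{jd/p} ‖f‖_{L^p} → 0` as
  `j → -∞` when `p < ∞` and `d ≥ 1`.

## References

* H. Bahouri, J.-Y. Chemin, R. Danchin, *Fourier Analysis and Nonlinear Partial Differential
  Equations*, Grundlehren 343, Springer (2011), doi:10.1007/978-3-642-16830-7: Def. 1.26 and the
  Examples following it (`𝓢'_h`; `L^p ⊂ 𝓢'_h` for finite `p`), §1.2 (translations and the Fourier
  transform), Lemma 2.1–2.2 (Bernstein, block multipliers), Thm. 2.36 (finite differences) and its proof.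
  [cite: BahouriCheminDanchin2011, Thm. 2.36]
* H. Triebel, *Theory of Function Spaces* (1983), §5.2.3, Theorem 2, eq. (7) (`M = 1`): the
  difference norm `sup_h |h|^{-s} ‖Δ_h f‖_{L^p}` is an equivalent norm on `Ḃ^s_{p,∞}`,
  `1 ≤ p ≤ ∞`, `s > 0` (homogeneous counterpart of Thm. 2.5.12). [cite: Triebel1983, §5.2.3 Thm. 2]
-/

noncomputable section

open MeasureTheory TemperedDistribution SchwartzMap Filter Topology Function Complex
open scoped SchwartzMap ENNReal NNReal FourierTransform Real RealInnerProductSpace ContDiff Convolution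

namespace Literature.Analysis.FunctionSpaces

/-! ## `L^p` norms of distributions: subadditivity -/

section LpNormAlgebra

variable {E : Type*} [NormedAddCommGroup E] [InnerProductSpace ℝ E] [FiniteDimensional ℝ E]
  [MeasurableSpace E] [BorelSpace E] {F : Type*} [NormedAddCommGroup F] [NormedSpace ℂ F]
  [CompleteSpace F]

/-- Subadditivity of the `L^p` norm of tempered distributions, difference form:
`‖u - v‖_{L^p} ≤ ‖u‖_{L^p} + ‖v‖_{L^p}` (both sides `∞` unless `u, v ∈ L^p`; the sum form is
`Literature.Analysis.FluidPDE.eLpNormDistrib_add_le` of `FluidPDE/CriticalRegularityProofs.lean`, not imported here).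
[folklore] -/
theorem eLpNormDistrib_sub_le {p : ℝ≥0∞} [Fact (1 ≤ p)] (u v : 𝓢'(E, F)) :
    eLpNormDistrib p (u - v) ≤ eLpNormDistrib p u + eLpNormDistrib p v := by
  by_cases hu : ∃ f : Lp F p (volume : Measure E), (f : 𝓢'(E, F)) = u
  · by_cases hv : ∃ g : Lp F p (volume : Measure E), (g : 𝓢'(E, F)) = v
    · obtain ⟨f, rfl⟩ := hu
      obtain ⟨g, rfl⟩ := hv
      have h : (((f - g : Lp F p (volume : Measure E))) : 𝓢'(E, F)) =
          (f : 𝓢'(E, F)) - (g : 𝓢'(E, F)) := by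
        rw [← Lp.toTemperedDistributionCLM_apply, ← Lp.toTemperedDistributionCLM_apply,
          ← Lp.toTemperedDistributionCLM_apply, map_sub]
      rw [← h, eLpNormDistrib_coe, eLpNormDistrib_coe, eLpNormDistrib_coe]
      exact enorm_sub_le
    · push Not at hv
      rw [eLpNormDistrib_of_forall_ne hv, add_top]
      exact le_top
  · push Not at hu
    rw [eLpNormDistrib_of_forall_ne hu, top_add]
    exact le_top

end LpNormAlgebra

/-! ## Translation as a Fourier multiplier -/

section FourierChar

/-! The three lemmas of this section restate `Literature.MathematicalPhysics.QuantumLattice.contDiff_fourierChar`,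
`Literature.MathematicalPhysics.QuantumLattice.iteratedDeriv_fourierChar`, `Literature.MathematicalPhysics.QuantumLattice.norm_iteratedFDeriv_fourierChar` of
`Literature/MathematicalPhysics/QuantumLattice/SchwartzFourierDensity.lean` (ten lines of proof in
all); they are repeated here, under distinct names, only to keep this function-space file free of
the quantum-lattice / Fourier-series imports of that module. -/

/-- The additive character `t ↦ e^{2πit}` as a complex-valued function is smooth (restates
`Literature.MathematicalPhysics.QuantumLattice.contDiff_fourierChar`, see the note above). [folklore] -/
theorem contDiff_fourierChar_coe : ContDiff ℝ ∞ (fun t : ℝ => (𝐞 t : ℂ)) := by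
  have h : (fun t : ℝ => (𝐞 t : ℂ)) = fun t : ℝ => Complex.exp (((2 * π * t : ℝ) : ℂ) * I) := by
    funext t; exact Real.fourierChar_apply t
  rw [h]
  refine Complex.contDiff_exp.comp ?_
  exact ((ofRealCLM.contDiff.comp (contDiff_const.mul contDiff_id)).mul contDiff_const)

/-- `Dⁿ e^{2πit} = (2πi)ⁿ e^{2πit}` (restates `Literature.MathematicalPhysics.QuantumLattice.iteratedDeriv_fourierChar`). [folklore] -/
theorem iteratedDeriv_fourierChar_coe (n : ℕ) :
    iteratedDeriv n (fun t : ℝ => (𝐞 t : ℂ)) = fun t : ℝ => (2 * π * I) ^ n * (𝐞 t : ℂ) := by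
  induction n with
  | zero => funext t; simp
  | succ n ih =>
      rw [iteratedDeriv_succ, ih]
      funext t
      rw [deriv_const_mul _ (Real.differentiable_fourierChar t), Real.deriv_fourierChar, pow_succ]
      ring

/-- `‖Dⁿ e^{2πit}‖ = (2π)ⁿ` (restates `Literature.MathematicalPhysics.QuantumLattice.norm_iteratedFDeriv_fourierChar`). [folklore] -/
theorem norm_iteratedFDeriv_fourierChar_coe (n : ℕ) (t : ℝ) :
    ‖iteratedFDeriv ℝ n (fun t : ℝ => (𝐞 t : ℂ)) t‖ = (2 * π) ^ n := by
  rw [norm_iteratedFDeriv_eq_norm_iteratedDeriv, iteratedDeriv_fourierChar_coe]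
  simp only [norm_mul, norm_pow, Circle.norm_coe, mul_one]
  congr 1
  simp [Real.pi_pos.le]

/-- `t ↦ e^{2πit}` has temperate growth (all derivatives are bounded). [folklore] -/
theorem hasTemperateGrowth_fourierChar_coe : (fun t : ℝ => (𝐞 t : ℂ)).HasTemperateGrowth := by
  refine ⟨contDiff_fourierChar_coe, fun n => ⟨0, (2 * π) ^ n, fun t => ?_⟩⟩
  rw [norm_iteratedFDeriv_fourierChar_coe, pow_zero, mul_one]

end FourierChar

section TranslationSymbol

variable {E : Type*} [NormedAddCommGroup E] [InnerProductSpace ℝ E]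

/-- The symbol `e_h(ξ) = e^{2πi⟨ξ, h⟩}` of the translation `τ_h u = u(· + h)`, viewed as the
Fourier multiplier `τ_h = e_h(D)` (BCD §1.2: `𝓕(τ_h u) = e^{i(h|ξ)} û`). [folklore] -/
def translSymbol (h : E) (ξ : E) : ℂ := (𝐞 ⟪ξ, h⟫ : ℂ)

/-- Unfolding `translSymbol`. [folklore] -/
theorem translSymbol_apply (h ξ : E) : translSymbol h ξ = (𝐞 ⟪ξ, h⟫ : ℂ) := rfl

/-- `e_h = (t ↦ e^{2πit}) ∘ ⟨·, h⟩`. [folklore] -/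
theorem translSymbol_eq_comp (h : E) :
    translSymbol h = (fun t : ℝ => (𝐞 t : ℂ)) ∘ fun ξ : E => ⟪ξ, h⟫ := rfl

/-- The translation symbol has temperate growth, so that `e_h(D)` is an honest Fourier
multiplier. [folklore] -/
theorem hasTemperateGrowth_translSymbol (h : E) : (translSymbol h).HasTemperateGrowth := by
  rw [translSymbol_eq_comp]
  exact hasTemperateGrowth_fourierChar_coe.comp (hasTemperateGrowth_inner_left h)

/-- `‖e_h(ξ)‖ = 1`. [folklore] -/
theorem norm_translSymbol (h ξ : E) : ‖translSymbol h ξ‖ = 1 := Circle.norm_coe _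

/-- `e_h(ξ) - 1` is small for small `⟨ξ, h⟩`: `‖e^{2πi⟨ξ,h⟩} - 1‖ ≤ 2π |⟨ξ, h⟩|`. [folklore] -/
theorem norm_translSymbol_sub_one_le (h ξ : E) :
    ‖translSymbol h ξ - 1‖ ≤ 2 * π * |⟪ξ, h⟫| := by
  rw [translSymbol_apply, Real.fourierChar_apply, mul_comm _ I]
  refine (Real.norm_exp_I_mul_ofReal_sub_one_le).trans ?_
  rw [Real.norm_eq_abs, abs_mul, abs_of_pos Real.two_pi_pos]

end TranslationSymbol

section TranslationMultiplier

variable {E : Type*} [NormedAddCommGroup E] [InnerProductSpace ℝ E] [FiniteDimensional ℝ E]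
  [MeasurableSpace E] [BorelSpace E]

/-- Modulation becomes translation under the Fourier transform:
`𝓕 (e_h θ)(w) = (𝓕 θ)(w - h)` for Schwartz `θ`. [folklore] -/
theorem fourier_smulLeftCLM_translSymbol_apply (h : E) (θ : 𝓢(E, ℂ)) (w : E) :
    (𝓕 (SchwartzMap.smulLeftCLM ℂ (translSymbol h) θ)) w = (𝓕 θ) (w - h) := by
  rw [SchwartzMap.fourier_coe, SchwartzMap.fourier_coe, Real.fourier_eq, Real.fourier_eq,
    SchwartzMap.smulLeftCLM_apply (hasTemperateGrowth_translSymbol h)]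
  refine integral_congr_ae (ae_of_all _ fun v => ?_)
  simp only [translSymbol_apply, smul_eq_mul, Circle.smul_def, inner_sub_right]
  rw [← mul_assoc, ← Circle.coe_mul, ← AddChar.map_add_eq_mul,
    show -⟪v, w⟫ + ⟪v, h⟫ = -(⟪v, w⟫ - ⟪v, h⟫) by ring]

/-- `𝓕 (e_h 𝓕⁻¹ u) = u(· - h)` for Schwartz `u`. [folklore] -/
theorem fourier_smulLeftCLM_translSymbol_fourierInv_apply (h : E) (u : 𝓢(E, ℂ)) (w : E) :
    (𝓕 (SchwartzMap.smulLeftCLM ℂ (translSymbol h) (𝓕⁻ u))) w = u (w - h) := by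
  rw [fourier_smulLeftCLM_translSymbol_apply, FourierTransform.fourier_fourierInv_eq]

variable {F : Type*} [NormedAddCommGroup F]

/-- The translate `τ_h g = g(· + h)` of an `L^p` function, as an element of `L^p`
(`MeasureTheory.Lp.compMeasurePreserving` for the measure-preserving map `x ↦ x + h`). [folklore] -/
def lpTranslate {p : ℝ≥0∞} (h : E) (g : Lp F p (volume : Measure E)) : Lp F p (volume : Measure E) :=
  Lp.compMeasurePreserving (fun x : E => x + h) (measurePreserving_add_right volume h) g

/-- `τ_h g = g(· + h)` almost everywhere. [folklore] -/
theorem coeFn_lpTranslate {p : ℝ≥0∞} (h : E) (g : Lp F p (volume : Measure E)) :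
    (lpTranslate h g : E → F) =ᵐ[volume] fun x => (g : E → F) (x + h) :=
  Lp.coeFn_compMeasurePreserving g (measurePreserving_add_right volume h)

/-- `‖τ_h g‖_{L^p} = ‖g‖_{L^p}`. [folklore] -/
theorem enorm_lpTranslate {p : ℝ≥0∞} (h : E) (g : Lp F p (volume : Measure E)) :
    ‖lpTranslate h g‖ₑ = ‖g‖ₑ := by
  rw [Lp.enorm_def, Lp.enorm_def, eLpNorm_congr_ae (coeFn_lpTranslate h g)]
  exact eLpNorm_comp_measurePreserving (Lp.aestronglyMeasurable g)
    (measurePreserving_add_right volume h)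

/-- The `L^p` norm of the finite difference: `‖τ_h g - g‖_{L^p} = ‖g(· + h) - g‖_{L^p}`, the
numerator of `Literature.Analysis.FunctionSpaces.eDiffQuotient`. [folklore] -/
theorem enorm_lpTranslate_sub {p : ℝ≥0∞} (h : E) (g : Lp F p (volume : Measure E)) :
    ‖lpTranslate h g - g‖ₑ = eLpNorm (fun x => (g : E → F) (x + h) - (g : E → F) x) p volume := by
  rw [Lp.enorm_def]
  refine eLpNorm_congr_ae ?_
  filter_upwards [Lp.coeFn_sub (lpTranslate h g) g, coeFn_lpTranslate h g] with x hx hx'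
  rw [hx, Pi.sub_apply, hx']

variable [NormedSpace ℂ F] [CompleteSpace F]

/-- **Translation is the Fourier multiplier `e_h(D)`** on `L^p ⊂ 𝓢'`: for `g ∈ L^p`,
`e_h(D) g = g(· + h)` (BCD §1.2, `𝓕(τ_h u) = e^{i(h|ξ)} û`; tested against `u`,
`⟨e_h(D) g, u⟩ = ∫ u(x - h) g(x) dx = ∫ u(y) g(y + h) dy`). [folklore] -/
theorem fourierMultiplierCLM_translSymbol_coe {p : ℝ≥0∞} [Fact (1 ≤ p)] (h : E)
    (g : Lp F p (volume : Measure E)) :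
    fourierMultiplierCLM F (translSymbol h) (g : 𝓢'(E, F)) =
      ((lpTranslate h g : Lp F p volume) : 𝓢'(E, F)) := by
  ext u
  rw [fourierMultiplierCLM_apply_apply, Lp.toTemperedDistribution_apply,
    Lp.toTemperedDistribution_apply]
  simp_rw [fourier_smulLeftCLM_translSymbol_fourierInv_apply]
  calc ∫ x, u (x - h) • (g : E → F) x
      = ∫ x, (fun y => u (y - h) • (g : E → F) y) (x + h) := by
        rw [integral_add_right_eq_self (fun y => u (y - h) • (g : E → F) y) h]
    _ = ∫ x, u x • (lpTranslate h g : E → F) x := by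
        refine integral_congr_ae ?_
        filter_upwards [coeFn_lpTranslate h g] with x hx
        simp only [add_sub_cancel_right, hx]

/-- Translation does not increase (in fact preserves) the `L^p` norm of tempered distributions:
`‖e_h(D) u‖_{L^p} ≤ ‖u‖_{L^p}` for `Literature.Analysis.FunctionSpaces.eLpNormDistrib`. [folklore] -/
theorem eLpNormDistrib_fourierMultiplierCLM_translSymbol_le {p : ℝ≥0∞} [Fact (1 ≤ p)] (h : E)
    (u : 𝓢'(E, F)) :
    eLpNormDistrib p (fourierMultiplierCLM F (translSymbol h) u) ≤ eLpNormDistrib p u := by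
  by_cases hu : ∃ g : Lp F p (volume : Measure E), (g : 𝓢'(E, F)) = u
  · obtain ⟨g, rfl⟩ := hu
    rw [fourierMultiplierCLM_translSymbol_coe, eLpNormDistrib_coe, eLpNormDistrib_coe,
      enorm_lpTranslate]
  · push Not at hu
    rw [eLpNormDistrib_of_forall_ne hu]
    exact le_top

/-- The finite difference `g(· + h) - g` of `g ∈ L^p` is the Fourier multiplier
`(e_h - 1)(D) g`. [folklore] -/
theorem fourierMultiplierCLM_translSymbol_sub_one_coe {p : ℝ≥0∞} [Fact (1 ≤ p)] (h : E)
    (g : Lp F p (volume : Measure E)) :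
    fourierMultiplierCLM F (fun ξ => translSymbol h ξ - 1) (g : 𝓢'(E, F)) =
      ((lpTranslate h g - g : Lp F p volume) : 𝓢'(E, F)) := by
  have h1 : (fun ξ : E => translSymbol h ξ - 1) = translSymbol h - fun _ => (1 : ℂ) := rfl
  rw [h1, fourierMultiplierCLM_sub (hasTemperateGrowth_translSymbol h)
    (Function.HasTemperateGrowth.const 1), sub_apply,
    fourierMultiplierCLM_translSymbol_coe, TemperedDistribution.fourierMultiplierCLM_const]
  rw [← Lp.toTemperedDistributionCLM_apply, ← Lp.toTemperedDistributionCLM_apply,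
    ← Lp.toTemperedDistributionCLM_apply, map_sub]
  simp

end TranslationMultiplier

/-! ## `L^p ⊂ 𝓢'_h` for finite `p`: the cut-offs of an `L^p` function -/

section LowFreqKernel

variable {E : Type*} [NormedAddCommGroup E] [InnerProductSpace ℝ E] [FiniteDimensional ℝ E]

variable (E) in
/-- The low-frequency symbol `χ(2^{-j} ·)` as a Schwartz function (smooth, compact support).
[folklore] -/
def lowFreqSymbolSchwartz (j : ℤ) : 𝓢(E, ℂ) :=
  (hasCompactSupport_lowFreqSymbol j).toSchwartzMap (contDiff_lowFreqSymbol j)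

/-- The Schwartz function `lowFreqSymbolSchwartz E j` is the symbol `χ(2^{-j} ·)`. [folklore] -/
@[simp]
theorem coe_lowFreqSymbolSchwartz (j : ℤ) :
    ((lowFreqSymbolSchwartz E j : 𝓢(E, ℂ)) : E → ℂ) = lowFreqSymbol j :=
  rfl

variable [MeasurableSpace E] [BorelSpace E]

variable (E) in
/-- The kernel `κ₀ = 𝓕⁻¹ χ ∈ 𝓢(E, ℂ)` of the low-frequency cut-off `Ṡ₀ = χ(D)`:
`Ṡ₀ f = κ₀ ⋆ f` on `L^p` (BCD (2.5) and §1.2). [folklore] -/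
def lowFreqZeroKernel : 𝓢(E, ℂ) := 𝓕⁻ (lowFreqSymbolSchwartz E 0 : 𝓢(E, ℂ))

variable {F : Type*} [NormedAddCommGroup F] [NormedSpace ℂ F] [CompleteSpace F]

/-- **`Ṡ₀` is bounded `L^p → L^∞`, tested**: for `g ∈ L^p` and a test function `ψ`,
`|⟨Ṡ₀ g, ψ⟩| ≤ ‖ψ‖_{L¹} ‖κ₀‖_{L^{p'}} ‖g‖_{L^p}` (`Ṡ₀ g = κ₀ ⋆ g` and Hölder's inequality;
BCD, proof of Lemma 2.1 / Examples after Def. 1.26: `L^p ⊂ 𝓢'_h` for finite `p`). [folklore] -/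
theorem norm_lowFreqCutoff_zero_coe_apply_le {p q : ℝ≥0∞} [Fact (1 ≤ p)] [q.HolderConjugate p]
    (g : Lp F p (volume : Measure E)) (ψ : 𝓢(E, ℂ)) :
    ‖lowFreqCutoff 0 (g : 𝓢'(E, F)) ψ‖ ≤
      (∫ y, ‖ψ y‖) *
        (eLpNorm (⇑(lowFreqZeroKernel E)) q volume * eLpNorm (g : E → F) p volume).toReal := by
  set K : 𝓢(E, ℂ) := lowFreqZeroKernel E with hK
  set B : ℝ≥0∞ := eLpNorm (⇑K) q volume * eLpNorm (g : E → F) p volume with hB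
  have hBtop : B ≠ ⊤ := ENNReal.mul_ne_top (K.eLpNorm_lt_top q volume).ne (Lp.memLp g).eLpNorm_lt_top.ne
  have hKm : AEStronglyMeasurable (⇑K) (volume : Measure E) := K.continuous.aestronglyMeasurable
  have hgm : AEStronglyMeasurable (g : E → F) volume := Lp.aestronglyMeasurable g
  have hrep : lowFreqCutoff 0 (g : 𝓢'(E, F)) ψ =
      ∫ y, ψ y • ((⇑K) ⋆[ContinuousLinearMap.lsmul ℂ ℂ, volume] (g : E → F)) y := by
    rw [lowFreqCutoff_apply, ← coe_lowFreqSymbolSchwartz,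
      fourierMultiplierCLM_coe_apply_eq_integral_convolution]
    rfl
  rw [hrep]
  have hpt : ∀ y, ‖((⇑K) ⋆[ContinuousLinearMap.lsmul ℂ ℂ, volume] (g : E → F)) y‖ ≤ B.toReal := by
    intro y
    have h := enorm_convolution_smul_le_eLpNorm_mul (μ := (volume : Measure E)) hKm hgm p q y
    rw [← hB] at h
    calc ‖((⇑K) ⋆[ContinuousLinearMap.lsmul ℂ ℂ, volume] (g : E → F)) y‖
        = (‖((⇑K) ⋆[ContinuousLinearMap.lsmul ℂ ℂ, volume] (g : E → F)) y‖ₑ).toReal := by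
          rw [toReal_enorm]
      _ ≤ B.toReal := ENNReal.toReal_mono hBtop h
  calc ‖∫ y, ψ y • ((⇑K) ⋆[ContinuousLinearMap.lsmul ℂ ℂ, volume] (g : E → F)) y‖
      ≤ ∫ y, ‖ψ y‖ * B.toReal := by
        refine norm_integral_le_of_norm_le (ψ.integrable.norm.mul_const _) (ae_of_all _ fun y => ?_)
        rw [norm_smul]
        exact mul_le_mul_of_nonneg_left (hpt y) (norm_nonneg _)
    _ = (∫ y, ‖ψ y‖) * B.toReal := integral_mul_const _ _

/-- The `L¹` norm of a dilated test function: `∫ ‖φ(a y)‖ dy = |a^d|⁻¹ ∫ ‖φ‖`. [folklore] -/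
theorem integral_norm_comp_smul (φ : 𝓢(E, ℂ)) (a : ℝ) :
    ∫ y, ‖φ (a • y)‖ = |(a ^ Module.finrank ℝ E)⁻¹| * ∫ y, ‖φ y‖ := by
  have := Measure.integral_comp_smul (volume : Measure E) (fun y : E => ‖φ y‖) a
  simpa using this

/-- **The low-frequency cut-offs of an `L^p` function, tested** (BCD, proof of Lemma 2.1 by
scaling): for `f ∈ L^p`, `j ∈ ℤ` and a test function `φ`,
`|⟨Ṡ_j f, φ⟩| ≤ ‖φ‖_{L¹} ‖κ₀‖_{L^{p'}} (2^{jd})^{1/p} ‖f‖_{L^p}` — the dyadic scaling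
`Ṡ_j f = (Ṡ₀ f(2^{-j} ·))(2^j ·)` and `‖f(2^{-j} ·)‖_{L^p} = 2^{jd/p} ‖f‖_{L^p}`. [folklore] -/
theorem norm_lowFreqCutoff_coe_apply_le {p q : ℝ≥0∞} [Fact (1 ≤ p)] [q.HolderConjugate p]
    (f : Lp F p (volume : Measure E)) (j : ℤ) (φ : 𝓢(E, ℂ)) :
    ‖lowFreqCutoff j (f : 𝓢'(E, F)) φ‖ ≤
      (∫ y, ‖φ y‖) * ((eLpNorm (⇑(lowFreqZeroKernel E)) q volume).toReal *
        ((((2 : ℝ) ^ j) ^ Module.finrank ℝ E) ^ p.toReal⁻¹ * (eLpNorm (f : E → F) p volume).toReal)) := by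
  set d : ℕ := Module.finrank ℝ E with hd
  set c : ℝˣ := Units.mk0 ((2 : ℝ) ^ j) (zpow_ne_zero j two_ne_zero) with hc
  have hc2 : (c : ℝ) = (2 : ℝ) ^ j := rfl
  have hcpos : (0 : ℝ) < (c : ℝ) := by rw [hc2]; positivity
  -- `f(2^{-j} ·) ∈ L^p`
  have hfc := memLp_comp_smul f c⁻¹
  set fc : Lp F p (volume : Measure E) := hfc.toLp _ with hfc_def
  have hw : distribDilate c⁻¹ (f : 𝓢'(E, F)) = (fc : 𝓢'(E, F)) :=
    distribDilate_coe_holds c⁻¹ f fc (MemLp.coeFn_toLp hfc)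
  -- `Ṡ_j f = (Ṡ₀ f_c)(2^j ·)`
  have hSj : lowFreqCutoff j (f : 𝓢'(E, F)) = distribDilate c (lowFreqCutoff 0 (fc : 𝓢'(E, F))) := by
    conv_lhs => rw [← distribDilate_distribDilate_inv c (f : 𝓢'(E, F)), hc,
      lowFreqCutoff_distribDilate j j, sub_self]
    rw [← hc, hw]
  -- norms of the dilated objects
  have hjac : |(((c⁻¹ : ℝˣ) : ℝ) ^ d)⁻¹| = (c : ℝ) ^ d := by
    rw [Units.val_inv_eq_inv_val, inv_pow, inv_inv, abs_of_pos (pow_pos hcpos d)]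
  have hψ : ∫ y, ‖(SchwartzMap.compCLMOfContinuousLinearEquiv ℂ
      (ContinuousLinearEquiv.smulLeft c⁻¹ : E ≃L[ℝ] E) φ) y‖ = (c : ℝ) ^ d * ∫ y, ‖φ y‖ := by
    simp only [compSmulLeft_apply]
    rw [integral_norm_comp_smul, hjac]
  have hfcn : eLpNorm (fc : E → F) p volume =
      ENNReal.ofReal ((c : ℝ) ^ d) ^ (1 / p).toReal * eLpNorm (f : E → F) p volume := by
    rw [hfc_def, eLpNorm_congr_ae (MemLp.coeFn_toLp hfc), eLpNorm_comp_smul p _ (c⁻¹).ne_zero, hjac]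
  rw [hSj, distribDilate_apply_apply, norm_smul]
  refine (mul_le_mul_of_nonneg_left (norm_lowFreqCutoff_zero_coe_apply_le (q := q) fc _)
    (norm_nonneg _)).trans ?_
  rw [hψ, hfcn, Complex.norm_real, Real.norm_of_nonneg (by positivity), ENNReal.toReal_mul,
    ENNReal.toReal_mul, ← ENNReal.toReal_rpow, ENNReal.toReal_ofReal (by positivity), one_div,
    ENNReal.toReal_inv, hc2]
  have hcd : |(2 : ℝ) ^ j|⁻¹ ^ d * ((2 : ℝ) ^ j) ^ d = 1 := by
    rw [abs_of_pos (zpow_pos two_pos j), inv_pow,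
      inv_mul_cancel₀ (pow_ne_zero d (zpow_ne_zero j two_ne_zero))]
  apply le_of_eq
  calc |(2 : ℝ) ^ j|⁻¹ ^ d * (((2 : ℝ) ^ j) ^ d * (∫ y, ‖φ y‖) *
        ((eLpNorm (⇑(lowFreqZeroKernel E)) q volume).toReal *
          ((((2 : ℝ) ^ j) ^ d) ^ p.toReal⁻¹ * (eLpNorm (f : E → F) p volume).toReal)))
      = (|(2 : ℝ) ^ j|⁻¹ ^ d * ((2 : ℝ) ^ j) ^ d) * ((∫ y, ‖φ y‖) *
        ((eLpNorm (⇑(lowFreqZeroKernel E)) q volume).toReal *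
          ((((2 : ℝ) ^ j) ^ d) ^ p.toReal⁻¹ * (eLpNorm (f : E → F) p volume).toReal))) := by ring
    _ = (∫ y, ‖φ y‖) * ((eLpNorm (⇑(lowFreqZeroKernel E)) q volume).toReal *
          ((((2 : ℝ) ^ j) ^ d) ^ p.toReal⁻¹ * (eLpNorm (f : E → F) p volume).toReal)) := by
        rw [hcd, one_mul]

/-- **`L^p ⊂ 𝓢'_h` for finite `p`** (BCD Def. 1.26 and the Examples following it;
here in dimension `d ≥ 1`): for `f ∈ L^p(E; F)` with `1 ≤ p < ∞` and `E ≠ {0}`, the low-frequency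
cut-offs `Ṡ_j f → 0` in `𝓢'(E, F)` as `j → -∞`, since `|⟨Ṡ_j f, φ⟩| ≲ 2^{jd/p} → 0`. In
dimension `0` (and for `p = ∞`) this fails: `Ṡ_j c = c` for constants.
[cite: BahouriCheminDanchin2011, Def. 1.26] -/
theorem tendsto_lowFreqCutoff_coe_atBot [Nontrivial E] {p : ℝ≥0∞} [hp : Fact (1 ≤ p)] (hp' : p ≠ ⊤)
    (f : Lp F p (volume : Measure E)) :
    Tendsto (fun j : ℤ => lowFreqCutoff j (f : 𝓢'(E, F))) atBot (𝓝 0) := by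
  haveI : ((1 - p⁻¹)⁻¹).HolderConjugate p :=
    (ENNReal.HolderConjugate.inv_one_sub_inv' hp.out).symm
  set q : ℝ≥0∞ := (1 - p⁻¹)⁻¹ with hq
  set d : ℕ := Module.finrank ℝ E with hd
  have hd0 : 0 < d := Module.finrank_pos
  have hp0 : 0 < p.toReal := ENNReal.toReal_pos (zero_lt_one.trans_le hp.out).ne' hp'
  rw [PointwiseConvergenceCLM.tendsto_iff_forall_tendsto]
  intro φ
  have h0 : (0 : 𝓢'(E, F)) φ = 0 := rfl
  rw [h0, tendsto_zero_iff_norm_tendsto_zero]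
  set A : ℝ := (∫ y, ‖φ y‖) * ((eLpNorm (⇑(lowFreqZeroKernel E)) q volume).toReal) with hA
  set M : ℝ := (eLpNorm (f : E → F) p volume).toReal with hM
  -- the scale factor `(2^{jd})^{1/p} = 2^{j d / p} → 0`
  have hscale : Tendsto (fun j : ℤ => (((2 : ℝ) ^ j) ^ d) ^ p.toReal⁻¹) atBot (𝓝 0) := by
    have h1 : Tendsto (fun j : ℤ => ((j : ℝ) * (d * p.toReal⁻¹))) atBot atBot :=
      (tendsto_intCast_atBot_iff (R := ℝ)).2 tendsto_id |>.atBot_mul_const (by positivity)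
    have h2 := (tendsto_rpow_atBot_of_base_gt_one 2 one_lt_two).comp h1
    refine h2.congr fun j => ?_
    simp only [Function.comp_apply]
    rw [← Real.rpow_intCast, ← Real.rpow_natCast, ← Real.rpow_mul zero_le_two,
      ← Real.rpow_mul zero_le_two, mul_assoc]
  have hlim : Tendsto (fun j : ℤ => A * ((((2 : ℝ) ^ j) ^ d) ^ p.toReal⁻¹ * M)) atBot (𝓝 0) := by
    simpa using (hscale.mul_const M).const_mul A
  refine squeeze_zero (fun j => norm_nonneg _) (fun j => ?_) hlim
  have h := norm_lowFreqCutoff_coe_apply_le (q := q) f j φ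
  simpa only [hA, hM, mul_assoc] using h

end LowFreqKernel

/-! ## The kernel of `Δ̇₀` and its moments -/

section DyadicKernel

variable {E : Type*} [NormedAddCommGroup E] [InnerProductSpace ℝ E] [FiniteDimensional ℝ E]

variable (E) in
/-- The dyadic symbol `φ₀ = χ - χ(2 ·)` of `Δ̇₀` as a Schwartz function (smooth, compact support).
[folklore] -/
def dyadicSchwartz : 𝓢(E, ℂ) :=
  (hasCompactSupport_dyadicSymbol 0).toSchwartzMap (contDiff_dyadicSymbol 0)

/-- The Schwartz function `dyadicSchwartz E` is the symbol `φ₀`. [folklore] -/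
@[simp]
theorem coe_dyadicSchwartz : ((dyadicSchwartz E : 𝓢(E, ℂ)) : E → ℂ) = dyadicSymbol 0 := rfl

omit [FiniteDimensional ℝ E] in
/-- `φ₀(0) = χ(0) - χ(0) = 0`: the dyadic symbol vanishes at the origin. [folklore] -/
theorem dyadicSymbol_apply_zero (j : ℤ) : dyadicSymbol j (0 : E) = 0 := by
  simp [dyadicSymbol]

variable [MeasurableSpace E] [BorelSpace E]

variable (E) in
/-- The kernel `k₀ = 𝓕⁻¹ φ₀ ∈ 𝓢(E, ℂ)` of the block `Δ̇₀ = φ₀(D)`: `Δ̇₀ f = k₀ ⋆ f` on `L^p`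
(BCD (2.5), §2.1: `Δ̇_j u = 2^{jd} ∫ h(2^j y) u(x - y) dy`, `h = 𝓕⁻¹φ`). [folklore] -/
def dyadicKernel : 𝓢(E, ℂ) := 𝓕⁻ (dyadicSchwartz E : 𝓢(E, ℂ))

/-- **The kernel of `Δ̇₀` has mean zero**: `∫ k₀ = (𝓕 k₀)(0) = φ₀(0) = 0` (BCD, proof of
Thm. 2.36: "as the mean value of `h` is zero"). [folklore] -/
theorem integral_dyadicKernel : ∫ t, (dyadicKernel E : 𝓢(E, ℂ)) t = 0 := by
  have h1 : ((𝓕 (dyadicKernel E : 𝓢(E, ℂ)) : 𝓢(E, ℂ)) : E → ℂ) 0 = 0 := by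
    rw [dyadicKernel, FourierTransform.fourier_fourierInv_eq, coe_dyadicSchwartz,
      dyadicSymbol_apply_zero]
  rw [SchwartzMap.fourier_coe] at h1
  simpa [Real.fourier_eq] using h1

/-- The `s p`-th moment of the kernel is finite: `∫ |k₀(t)| ‖t‖^{sp} dt < ∞` (Schwartz decay:
`‖t‖^{sp} ≤ 1 + ‖t‖^n` for an integer `n ≥ sp`). [folklore] -/
theorem lintegral_enorm_mul_ofReal_norm_rpow_lt_top (k : 𝓢(E, ℂ)) {r : ℝ} (hr : 0 ≤ r) :
    ∫⁻ t, ‖k t‖ₑ * ENNReal.ofReal (‖t‖ ^ r) < ⊤ := by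
  set n : ℕ := ⌈r⌉₊ with hn
  have hrn : r ≤ n := Nat.le_ceil r
  have hpt : ∀ t : E, ‖t‖ ^ r ≤ 1 + ‖t‖ ^ n := by
    intro t
    rcases le_or_gt ‖t‖ 1 with ht | ht
    · calc ‖t‖ ^ r ≤ 1 := Real.rpow_le_one (norm_nonneg _) ht hr
        _ ≤ 1 + ‖t‖ ^ n := le_add_of_nonneg_right (by positivity)
    · calc ‖t‖ ^ r ≤ ‖t‖ ^ (n : ℝ) := Real.rpow_le_rpow_of_exponent_le ht.le hrn
        _ = ‖t‖ ^ n := Real.rpow_natCast _ _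
        _ ≤ 1 + ‖t‖ ^ n := le_add_of_nonneg_left zero_le_one
  have hI1 : ∫⁻ t, ‖k t‖ₑ < ⊤ := (k.integrable (μ := (volume : Measure E))).hasFiniteIntegral
  have hI2 : ∫⁻ t, ENNReal.ofReal (‖t‖ ^ n * ‖k t‖) < ⊤ :=
    (k.integrable_pow_mul (volume : Measure E) n).lintegral_lt_top
  calc ∫⁻ t, ‖k t‖ₑ * ENNReal.ofReal (‖t‖ ^ r)
      ≤ ∫⁻ t, (‖k t‖ₑ + ENNReal.ofReal (‖t‖ ^ n * ‖k t‖)) := by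
        refine lintegral_mono fun t => ?_
        calc ‖k t‖ₑ * ENNReal.ofReal (‖t‖ ^ r) ≤ ‖k t‖ₑ * ENNReal.ofReal (1 + ‖t‖ ^ n) := by
              gcongr
              exact hpt t
          _ = ‖k t‖ₑ + ENNReal.ofReal (‖t‖ ^ n * ‖k t‖) := by
              rw [ENNReal.ofReal_add zero_le_one (by positivity), ENNReal.ofReal_one, mul_add, mul_one,
                ENNReal.ofReal_mul (by positivity), ← ofReal_norm, mul_comm (ENNReal.ofReal ‖k t‖)]
    _ = (∫⁻ t, ‖k t‖ₑ) + ∫⁻ t, ENNReal.ofReal (‖t‖ ^ n * ‖k t‖) := by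
        rw [lintegral_add_left' k.continuous.aestronglyMeasurable.enorm]
    _ < ⊤ := ENNReal.add_lt_top.2 ⟨hI1, hI2⟩

variable {F : Type*} [NormedAddCommGroup F] [NormedSpace ℂ F]

/-- Hölder: for `v ∈ L^p` and Schwartz `k`, `t ↦ k(t) • v(x - t)` is integrable for every `x`
(`k ∈ L^{p'}`, `v(x - ·) ∈ L^p`). [folklore] -/
theorem integrable_schwartz_smul_Lp_sub {p : ℝ≥0∞} [hp : Fact (1 ≤ p)]
    (k : 𝓢(E, ℂ)) (v : Lp F p (volume : Measure E)) (x : E) :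
    Integrable (fun t => k t • (v : E → F) (x - t)) (volume : Measure E) := by
  haveI : p.HolderConjugate (1 - p⁻¹)⁻¹ := ENNReal.HolderConjugate.inv_one_sub_inv' hp.out
  have hv : MemLp (fun t => (v : E → F) (x - t)) p (volume : Measure E) :=
    (Lp.memLp v).comp_measurePreserving (Measure.measurePreserving_sub_left volume x)
  have := MemLp.smul (r := 1) hv (k.memLp ((1 - p⁻¹)⁻¹) (volume : Measure E))
  exact memLp_one_iff_integrable.1 this

variable [CompleteSpace F]

/-- **The block through the difference**: since `∫ k₀ = 0`,
`(k₀ ⋆ v)(x) = ∫ k₀(t) (v(x - t) - v(x)) dt`, whence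
`‖(k₀ ⋆ v)(x)‖ ≤ ∫ |k₀(t)| ‖v(x - t) - v(x)‖ dt` (BCD, proof of Thm. 2.36). [folklore] -/
theorem enorm_dyadicKernel_convolution_le {p : ℝ≥0∞} [Fact (1 ≤ p)]
    (v : Lp F p (volume : Measure E)) (x : E) :
    ‖((⇑(dyadicKernel E)) ⋆[ContinuousLinearMap.lsmul ℂ ℂ, volume] (v : E → F)) x‖ₑ ≤
      ∫⁻ t, ‖(dyadicKernel E) t‖ₑ * ‖(v : E → F) (x - t) - (v : E → F) x‖ₑ := by
  set k : 𝓢(E, ℂ) := dyadicKernel E with hk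
  have hint := integrable_schwartz_smul_Lp_sub k v x
  have hconst : Integrable (fun t => k t • (v : E → F) x) (volume : Measure E) :=
    (k.integrable (μ := volume)).smul_const _
  have hzero : ∫ t, k t • (v : E → F) x = 0 := by
    rw [integral_smul_const, hk, integral_dyadicKernel, zero_smul]
  have hrepr : ((⇑k) ⋆[ContinuousLinearMap.lsmul ℂ ℂ, volume] (v : E → F)) x =
      ∫ t, k t • ((v : E → F) (x - t) - (v : E → F) x) := by
    rw [convolution_def]
    simp only [ContinuousLinearMap.lsmul_apply, smul_sub]
    rw [integral_sub hint hconst, hzero, sub_zero]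
  rw [hrepr]
  refine (enorm_integral_le_lintegral_enorm _).trans_eq ?_
  simp_rw [enorm_smul]

omit [NormedSpace ℂ F] [CompleteSpace F] in
/-- The inner `x`-integral: `∫ ‖v(x - t) - v(x)‖^p dx ≤ ([v]_{B^s_{p,∞}} ‖t‖^s)^p`, the defining
estimate of the difference seminorm (`Literature.Analysis.FunctionSpaces.eLpNorm_sub_le_eBesovSupSeminorm_mul` at the increment
`-t`). [folklore] -/
theorem lintegral_rpow_enorm_sub_le {p : ℝ≥0∞} (hp0 : p ≠ 0) (hp : p ≠ ⊤) (s : ℝ)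
    (v : E → F) (t : E) :
    ∫⁻ x, ‖v (x - t) - v x‖ₑ ^ p.toReal ≤
      (eBesovSupSeminorm s p v volume * ENNReal.ofReal (‖t‖ ^ s)) ^ p.toReal := by
  have hp' : 0 < p.toReal := ENNReal.toReal_pos hp0 hp
  have heq : ∫⁻ x, ‖v (x - t) - v x‖ₑ ^ p.toReal =
      eLpNorm (fun x => v (x + -t) - v x) p volume ^ p.toReal := by
    rw [eLpNorm_eq_lintegral_rpow_enorm_toReal hp0 hp, ← ENNReal.rpow_mul, one_div,
      inv_mul_cancel₀ hp'.ne', ENNReal.rpow_one]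
    simp_rw [sub_eq_add_neg]
  rw [heq]
  refine ENNReal.rpow_le_rpow ?_ hp'.le
  rcases eq_or_ne t 0 with rfl | ht
  · simp
  · simpa only [norm_neg] using
      eLpNorm_sub_le_eBesovSupSeminorm_mul (s := s) (p := p) (f := v) (μ := volume) (neg_ne_zero.2 ht)

/-- **The `L^p` norm of the block through the difference seminorm, at frequency `1`**
(BCD, proof of Thm. 2.36, first inequality:
"`‖Δ̇_j u‖_{L^p} ≤ 2^{jd} ∫ |h(2^j y)| ‖τ_y u - u‖_{L^p} dy`",
here with Hölder's inequality against the finite measure `|k₀(t)| dt` in place of Minkowski's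
integral inequality): for `v ∈ L^p`, `1 ≤ p < ∞`,
`∫ ‖(k₀ ⋆ v)(x)‖^p dx ≤ ‖k₀‖₁^{p-1} · [v]^p_{B^s_{p,∞}} · ∫ |k₀(t)| ‖t‖^{sp} dt`. [folklore] -/
theorem lintegral_rpow_enorm_dyadicKernel_convolution_le {p : ℝ≥0∞} [hp1 : Fact (1 ≤ p)] (hp : p ≠ ⊤)
    (s : ℝ) (v : Lp F p (volume : Measure E)) :
    ∫⁻ x, ‖((⇑(dyadicKernel E)) ⋆[ContinuousLinearMap.lsmul ℂ ℂ, volume] (v : E → F)) x‖ₑ ^ p.toReal ≤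
      (∫⁻ t, ‖(dyadicKernel E) t‖ₑ) ^ (p.toReal - 1) *
        (eBesovSupSeminorm s p (v : E → F) volume ^ p.toReal *
          ∫⁻ t, ‖(dyadicKernel E) t‖ₑ * ENNReal.ofReal (‖t‖ ^ s) ^ p.toReal) := by
  set k : 𝓢(E, ℂ) := dyadicKernel E with hk
  set A : ℝ≥0∞ := eBesovSupSeminorm s p (v : E → F) volume with hA
  have hp0 : p ≠ 0 := (zero_lt_one.trans_le hp1.out).ne'
  have hp' : 1 ≤ p.toReal := by
    simpa using (ENNReal.toReal_le_toReal ENNReal.one_ne_top hp).2 hp1.out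
  have hp'0 : 0 < p.toReal := one_pos.trans_le hp'
  set I₁ : ℝ≥0∞ := ∫⁻ t, ‖k t‖ₑ with hI₁
  have hI₁top : I₁ ≠ ⊤ := (k.integrable (μ := (volume : Measure E))).hasFiniteIntegral.ne
  -- measurability
  have hvm : AEStronglyMeasurable (v : E → F) volume := Lp.aestronglyMeasurable v
  have hKm : AEMeasurable (fun t : E => ‖k t‖ₑ) volume := k.continuous.aestronglyMeasurable.enorm
  have hD2 : AEStronglyMeasurable (fun z : E × E => (v : E → F) (z.1 - z.2) - (v : E → F) z.1)
      ((volume : Measure E).prod volume) :=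
    (hvm.comp_quasiMeasurePreserving (quasiMeasurePreserving_sub_of_right_invariant volume volume)).sub
      hvm.comp_fst
  have hD1 : ∀ x, AEMeasurable (fun t => ‖(v : E → F) (x - t) - (v : E → F) x‖ₑ) volume := fun x =>
    ((hvm.comp_measurePreserving (Measure.measurePreserving_sub_left volume x)).sub
      aestronglyMeasurable_const).enorm
  have hG : AEMeasurable
      (fun z : E × E => ‖k z.2‖ₑ * ‖(v : E → F) (z.1 - z.2) - (v : E → F) z.1‖ₑ ^ p.toReal)
      ((volume : Measure E).prod volume) :=
    hKm.comp_snd.mul (hD2.enorm.pow_const _)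
  calc ∫⁻ x, ‖((⇑k) ⋆[ContinuousLinearMap.lsmul ℂ ℂ, volume] (v : E → F)) x‖ₑ ^ p.toReal
      ≤ ∫⁻ x, (∫⁻ t, ‖k t‖ₑ * ‖(v : E → F) (x - t) - (v : E → F) x‖ₑ) ^ p.toReal :=
        lintegral_mono fun x =>
          ENNReal.rpow_le_rpow (enorm_dyadicKernel_convolution_le v x) hp'0.le
    _ ≤ ∫⁻ x, I₁ ^ (p.toReal - 1) *
          ∫⁻ t, ‖k t‖ₑ * ‖(v : E → F) (x - t) - (v : E → F) x‖ₑ ^ p.toReal :=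
        lintegral_mono fun x => UnboundedOperators.lintegral_mul_rpow_le_of_one_le hKm (hD1 x) hp'
    _ = I₁ ^ (p.toReal - 1) *
          ∫⁻ t, ∫⁻ x, ‖k t‖ₑ * ‖(v : E → F) (x - t) - (v : E → F) x‖ₑ ^ p.toReal := by
        rw [lintegral_const_mul' _ _ (ENNReal.rpow_ne_top_of_nonneg (by linarith) hI₁top),
          lintegral_lintegral_swap hG]
    _ = I₁ ^ (p.toReal - 1) *
          ∫⁻ t, ‖k t‖ₑ * ∫⁻ x, ‖(v : E → F) (x - t) - (v : E → F) x‖ₑ ^ p.toReal := by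
        congr 1
        refine lintegral_congr fun t => ?_
        rw [lintegral_const_mul' _ _ enorm_ne_top]
    _ ≤ I₁ ^ (p.toReal - 1) *
          ∫⁻ t, ‖k t‖ₑ * (A * ENNReal.ofReal (‖t‖ ^ s)) ^ p.toReal := by
        gcongr with t
        exact lintegral_rpow_enorm_sub_le hp0 hp s _ t
    _ = I₁ ^ (p.toReal - 1) * (A ^ p.toReal * ∫⁻ t, ‖k t‖ₑ * ENNReal.ofReal (‖t‖ ^ s) ^ p.toReal) := by
        congr 1
        have hm : AEMeasurable (fun t : E => ‖k t‖ₑ * ENNReal.ofReal (‖t‖ ^ s) ^ p.toReal) volume :=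
          hKm.mul ((measurable_norm.pow_const s).ennreal_ofReal.pow_const _).aemeasurable
        rw [← lintegral_const_mul'' _ hm]
        refine lintegral_congr fun t => ?_
        rw [ENNReal.mul_rpow_of_nonneg _ _ hp'0.le]
        ring

/-- The constant of the finite-difference bound for `Δ̇₀`:
`C = (‖k₀‖₁^{p-1} ∫ |k₀(t)| ‖t‖^{sp} dt)^{1/p} < ∞`. [folklore] -/
def blockDiffConst (E : Type*) [NormedAddCommGroup E] [InnerProductSpace ℝ E] [FiniteDimensional ℝ E]
    [MeasurableSpace E] [BorelSpace E] (s : ℝ) (p : ℝ≥0∞) : ℝ≥0∞ :=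
  ((∫⁻ t, ‖(dyadicKernel E) t‖ₑ) ^ (p.toReal - 1) *
    ∫⁻ t, ‖(dyadicKernel E) t‖ₑ * ENNReal.ofReal (‖t‖ ^ s) ^ p.toReal) ^ p.toReal⁻¹

omit [CompleteSpace F] in
/-- The constant `blockDiffConst E s p` is finite for `0 ≤ s`, `1 ≤ p < ∞`. [folklore] -/
theorem blockDiffConst_lt_top {s : ℝ} (hs : 0 ≤ s) {p : ℝ≥0∞} [hp1 : Fact (1 ≤ p)] (hp : p ≠ ⊤) :
    blockDiffConst E s p < ⊤ := by
  have hp' : 1 ≤ p.toReal := by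
    simpa using (ENNReal.toReal_le_toReal ENNReal.one_ne_top hp).2 hp1.out
  unfold blockDiffConst
  refine ENNReal.rpow_lt_top_of_nonneg (by positivity) (ENNReal.mul_ne_top ?_ ?_)
  · exact ENNReal.rpow_ne_top_of_nonneg (by linarith)
      ((dyadicKernel E).integrable (μ := (volume : Measure E))).hasFiniteIntegral.ne
  · have h := lintegral_enorm_mul_ofReal_norm_rpow_lt_top (dyadicKernel E) (r := s * p.toReal)
      (by positivity)
    refine ne_of_lt (lt_of_le_of_lt (le_of_eq ?_) h)
    refine lintegral_congr fun t => ?_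
    rw [ENNReal.ofReal_rpow_of_nonneg (by positivity) (by linarith), ← Real.rpow_mul (norm_nonneg _)]

/-- **`‖k₀ ⋆ v‖_{L^p} ≤ C [v]_{B^s_{p,∞}}`** for `v ∈ L^p`, `1 ≤ p < ∞` (BCD, proof of Thm. 2.36,
first inequality, at frequency `1`). [folklore] -/
theorem eLpNorm_dyadicKernel_convolution_le {p : ℝ≥0∞} [hp1 : Fact (1 ≤ p)] (hp : p ≠ ⊤)
    (s : ℝ) (v : Lp F p (volume : Measure E)) :
    eLpNorm ((⇑(dyadicKernel E)) ⋆[ContinuousLinearMap.lsmul ℂ ℂ, volume] (v : E → F)) p volume ≤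
      blockDiffConst E s p * eBesovSupSeminorm s p (v : E → F) volume := by
  have hp0 : p ≠ 0 := (zero_lt_one.trans_le hp1.out).ne'
  have hp' : 1 ≤ p.toReal := by
    simpa using (ENNReal.toReal_le_toReal ENNReal.one_ne_top hp).2 hp1.out
  have hp'0 : 0 < p.toReal := one_pos.trans_le hp'
  have h := lintegral_rpow_enorm_dyadicKernel_convolution_le hp s v
  rw [eLpNorm_eq_lintegral_rpow_enorm_toReal hp0 hp, one_div, blockDiffConst]
  calc (∫⁻ x, ‖((⇑(dyadicKernel E)) ⋆[ContinuousLinearMap.lsmul ℂ ℂ, volume] (v : E → F)) x‖ₑ ^ p.toReal) ^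
        p.toReal⁻¹
      ≤ ((∫⁻ t, ‖(dyadicKernel E) t‖ₑ) ^ (p.toReal - 1) *
          (eBesovSupSeminorm s p (v : E → F) volume ^ p.toReal *
            ∫⁻ t, ‖(dyadicKernel E) t‖ₑ * ENNReal.ofReal (‖t‖ ^ s) ^ p.toReal)) ^ p.toReal⁻¹ :=
        ENNReal.rpow_le_rpow h (by positivity)
    _ = ((∫⁻ t, ‖(dyadicKernel E) t‖ₑ) ^ (p.toReal - 1) *
          ∫⁻ t, ‖(dyadicKernel E) t‖ₑ * ENNReal.ofReal (‖t‖ ^ s) ^ p.toReal) ^ p.toReal⁻¹ *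
          eBesovSupSeminorm s p (v : E → F) volume := by
        rw [mul_left_comm, ENNReal.mul_rpow_of_nonneg _ _ (by positivity),
          ENNReal.rpow_rpow_inv hp'0.ne', mul_comm]

/-- **`‖Δ̇₀ v‖_{L^p} ≤ C [v]_{B^s_{p,∞}}`** for `v ∈ L^p`, `1 ≤ p < ∞`, at the level of
`Literature.Analysis.FunctionSpaces.eLpNormDistrib` (`Δ̇₀ v = k₀ ⋆ v` as distributions). [folklore] -/
theorem eLpNormDistrib_lpBlock_zero_coe_le {p : ℝ≥0∞} [hp1 : Fact (1 ≤ p)] (hp : p ≠ ⊤)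
    (s : ℝ) (v : Lp F p (volume : Measure E)) :
    eLpNormDistrib p (lpBlock 0 (v : 𝓢'(E, F))) ≤
      blockDiffConst E s p * eBesovSupSeminorm s p (v : E → F) volume := by
  set k : 𝓢(E, ℂ) := dyadicKernel E with hk
  have hK : AEStronglyMeasurable (⇑k) (volume : Measure E) := k.continuous.aestronglyMeasurable
  have hvm : AEStronglyMeasurable (v : E → F) volume := Lp.aestronglyMeasurable v
  have hg : MemLp ((⇑k) ⋆[ContinuousLinearMap.lsmul ℂ ℂ, volume] (v : E → F)) p volume :=
    memLp_convolution_smul (k.integrable (μ := volume)) (Lp.memLp v) hp1.out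
  have hrep : ((hg.toLp _ : Lp F p (volume : Measure E)) : 𝓢'(E, F)) = lpBlock 0 (v : 𝓢'(E, F)) := by
    rw [lpBlock_apply, ← coe_dyadicSchwartz]
    ext u
    rw [Lp.toTemperedDistribution_apply, fourierMultiplierCLM_coe_apply_eq_integral_convolution]
    refine integral_congr_ae ?_
    filter_upwards [hg.coeFn_toLp] with y hy
    rw [hy]
    rfl
  calc eLpNormDistrib p (lpBlock 0 (v : 𝓢'(E, F)))
      ≤ ‖(hg.toLp _ : Lp F p (volume : Measure E))‖ₑ := by rw [← hrep]; exact eLpNormDistrib_coe_le _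
    _ = eLpNorm ((⇑k) ⋆[ContinuousLinearMap.lsmul ℂ ℂ, volume] (v : E → F)) p volume := Lp.enorm_toLp hg
    _ ≤ blockDiffConst E s p * eBesovSupSeminorm s p (v : E → F) volume :=
        eLpNorm_dyadicKernel_convolution_le hp s v

end DyadicKernel

/-! ## All frequencies by dyadic scaling -/

section BlockScaling

variable {E : Type*} [NormedAddCommGroup E] [InnerProductSpace ℝ E] [FiniteDimensional ℝ E]
  [MeasurableSpace E] [BorelSpace E] {F : Type*} [NormedAddCommGroup F]

/-- The difference seminorm only depends on the a.e. class of the function (translations are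
quasi-measure-preserving for Lebesgue measure). [folklore] -/
theorem eBesovSupSeminorm_congr_ae {s : ℝ} {p : ℝ≥0∞} {f g : E → F} (hfg : f =ᵐ[volume] g) :
    eBesovSupSeminorm s p f volume = eBesovSupSeminorm s p g volume := by
  simp only [eBesovSupSeminorm, eDiffQuotient]
  congr 1
  funext h
  congr 1
  funext _
  rw [eLpNorm_congr_ae]
  filter_upwards [hfg,
    (measurePreserving_add_right (volume : Measure E) h).quasiMeasurePreserving.ae_eq_comp hfg]
    with x hx hx'
  simp only [Function.comp_apply] at hx'
  rw [hx, hx']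

/-- `2^{j}` to a real power, through `ℝ≥0∞`: `ofReal ((2^j)^s) = 2^{js}`. [folklore] -/
theorem ofReal_two_zpow_rpow (j : ℤ) (s : ℝ) :
    ENNReal.ofReal (((2 : ℝ) ^ j) ^ s) = (2 : ℝ≥0∞) ^ ((j : ℝ) * s) := by
  rw [← Real.rpow_intCast, ← Real.rpow_mul zero_le_two, ← ENNReal.ofReal_rpow_of_pos two_pos,
    ENNReal.ofReal_ofNat]

/-- **Scaling of the difference seminorm**: `[f(a ·)]_{B^s_{p,∞}} ≤ a^s |a^d|^{-1/p} [f]_{B^s_{p,∞}}`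
for `a > 0` (`f(a(x + h)) - f(ax) = g(ax)` with `g = f(· + ah) - f`,
`‖g(a ·)‖_{L^p} = |a^d|^{-1/p} ‖g‖_{L^p}`
and `‖ah‖^s = a^s ‖h‖^s`; BCD, proof of Prop. 2.18 / Thm. 2.36). [folklore] -/
theorem eBesovSupSeminorm_comp_smul_le (s : ℝ) (p : ℝ≥0∞) (f : E → F) {a : ℝ} (ha : 0 < a) :
    eBesovSupSeminorm s p (fun x => f (a • x)) volume ≤
      ENNReal.ofReal (a ^ s) * ENNReal.ofReal |(a ^ Module.finrank ℝ E)⁻¹| ^ (1 / p).toReal *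
        eBesovSupSeminorm s p f volume := by
  refine iSup₂_le fun h hh => ?_
  rw [eDiffQuotient_def]
  have heq : (fun x => f (a • (x + h)) - f (a • x)) =
      fun x => (fun y => f (y + a • h) - f y) (a • x) := by
    funext x
    simp only [smul_add]
  change eLpNorm (fun x => f (a • (x + h)) - f (a • x)) p volume / ENNReal.ofReal (‖h‖ ^ s) ≤ _
  rw [heq, eLpNorm_comp_smul p (fun y => f (y + a • h) - f y) ha.ne']
  have hah : a • h ≠ 0 := smul_ne_zero ha.ne' hh
  have hb := eLpNorm_sub_le_eBesovSupSeminorm_mul (s := s) (p := p) (f := f) (μ := volume) hah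
  rw [norm_smul, Real.norm_of_nonneg ha.le, Real.mul_rpow ha.le (norm_nonneg _),
    ENNReal.ofReal_mul (by positivity)] at hb
  refine ENNReal.div_le_of_le_mul ?_
  calc ENNReal.ofReal |(a ^ Module.finrank ℝ E)⁻¹| ^ (1 / p).toReal *
        eLpNorm (fun y => f (y + a • h) - f y) p volume
      ≤ ENNReal.ofReal |(a ^ Module.finrank ℝ E)⁻¹| ^ (1 / p).toReal *
          (eBesovSupSeminorm s p f volume * (ENNReal.ofReal (a ^ s) * ENNReal.ofReal (‖h‖ ^ s))) := by
        gcongr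
    _ = ENNReal.ofReal (a ^ s) * ENNReal.ofReal |(a ^ Module.finrank ℝ E)⁻¹| ^ (1 / p).toReal *
          eBesovSupSeminorm s p f volume * ENNReal.ofReal (‖h‖ ^ s) := by ring

variable [NormedSpace ℂ F] [CompleteSpace F]

/-- **`‖Δ̇_j f‖_{L^p} ≤ C 2^{-js} [f]_{B^s_{p,∞}}`** for `f ∈ L^p`, `1 ≤ p < ∞`, all `j ∈ ℤ`
(BCD, proof of Thm. 2.36, first inequality: `2^{js} ‖Δ̇_j u‖_{L^p} ≲ sup_y ‖τ_y u - u‖_{L^p}/|y|^s`),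
by the dyadic scaling `Δ̇_j f = (Δ̇₀ f(2^{-j} ·))(2^j ·)` from the case `j = 0`
(`eLpNormDistrib_lpBlock_zero_coe_le`). [cite: BahouriCheminDanchin2011, Thm. 2.36] -/
theorem eLpNormDistrib_lpBlock_coe_le {s : ℝ} {p : ℝ≥0∞} [hp1 : Fact (1 ≤ p)] (hp : p ≠ ⊤)
    (f : Lp F p (volume : Measure E)) (j : ℤ) :
    eLpNormDistrib p (lpBlock j (f : 𝓢'(E, F))) ≤
      blockDiffConst E s p * (2 : ℝ≥0∞) ^ (-((j : ℝ) * s)) *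
        eBesovSupSeminorm s p (f : E → F) volume := by
  set d : ℕ := Module.finrank ℝ E with hd
  set c : ℝˣ := Units.mk0 ((2 : ℝ) ^ j) (zpow_ne_zero j two_ne_zero) with hc
  have hcinv : ((c⁻¹ : ℝˣ) : ℝ) = (2 : ℝ) ^ (-j) := by
    rw [Units.val_inv_eq_inv_val, zpow_neg]; rfl
  have hfc := memLp_comp_smul f c⁻¹
  set fc : Lp F p (volume : Measure E) := hfc.toLp _ with hfc_def
  have hw : distribDilate c⁻¹ (f : 𝓢'(E, F)) = (fc : 𝓢'(E, F)) :=
    distribDilate_coe_holds c⁻¹ f fc (MemLp.coeFn_toLp hfc)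
  have hblock : lpBlock j (f : 𝓢'(E, F)) = distribDilate c (lpBlock 0 (fc : 𝓢'(E, F))) := by
    conv_lhs => rw [← distribDilate_distribDilate_inv c (f : 𝓢'(E, F)), hc,
      lpBlock_distribDilate_holds j j, sub_self]
    rw [← hc, hw]
  -- the seminorm of `f(2^{-j} ·)`
  have hsemi : eBesovSupSeminorm s p (fc : E → F) volume ≤
      (2 : ℝ≥0∞) ^ (((-j : ℤ) : ℝ) * s) * (2 : ℝ≥0∞) ^ (-(((-j : ℤ) : ℝ) * d) / p.toReal) *
        eBesovSupSeminorm s p (f : E → F) volume := by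
    rw [eBesovSupSeminorm_congr_ae (MemLp.coeFn_toLp hfc), hcinv, ← ofReal_two_zpow_rpow,
      ← dilateConst_two_zpow]
    exact eBesovSupSeminorm_comp_smul_le s p _ (zpow_pos two_pos _)
  rw [hblock, eLpNormDistrib_distribDilate, show ((c : ℝˣ) : ℝ) = (2 : ℝ) ^ j from rfl,
    dilateConst_two_zpow]
  calc (2 : ℝ≥0∞) ^ (-((j : ℝ) * d) / p.toReal) * eLpNormDistrib p (lpBlock 0 (fc : 𝓢'(E, F)))
      ≤ (2 : ℝ≥0∞) ^ (-((j : ℝ) * d) / p.toReal) *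
          (blockDiffConst E s p * eBesovSupSeminorm s p (fc : E → F) volume) := by
        gcongr
        exact eLpNormDistrib_lpBlock_zero_coe_le hp s fc
    _ ≤ (2 : ℝ≥0∞) ^ (-((j : ℝ) * d) / p.toReal) *
          (blockDiffConst E s p * ((2 : ℝ≥0∞) ^ (((-j : ℤ) : ℝ) * s) *
            (2 : ℝ≥0∞) ^ (-(((-j : ℤ) : ℝ) * d) / p.toReal) * eBesovSupSeminorm s p (f : E → F) volume)) := by
        gcongr
    _ = blockDiffConst E s p * ((2 : ℝ≥0∞) ^ (-((j : ℝ) * d) / p.toReal) *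
          (2 : ℝ≥0∞) ^ (-(((-j : ℤ) : ℝ) * d) / p.toReal)) * (2 : ℝ≥0∞) ^ (((-j : ℤ) : ℝ) * s) *
          eBesovSupSeminorm s p (f : E → F) volume := by ring
    _ = blockDiffConst E s p * (2 : ℝ≥0∞) ^ (-((j : ℝ) * s)) * eBesovSupSeminorm s p (f : E → F) volume := by
        rw [two_rpow_mul_two_rpow]
        push_cast
        rw [show -((j : ℝ) * d) / p.toReal + -(-(j : ℝ) * d) / p.toReal = 0 by ring, ENNReal.rpow_zero,
          mul_one, show -(j : ℝ) * s = -((j : ℝ) * s) by ring]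

/-- **The Besov weights through the difference seminorm**: `2^{js} ‖Δ̇_j f‖_{L^p} ≤ C [f]_{B^s_{p,∞}}`
for all `j`, and hence `‖f‖_{Ḃ^s_{p,∞}} ≤ C [f]_{B^s_{p,∞}}` (BCD Thm. 2.36, first inequality, `r = ∞`).
[cite: BahouriCheminDanchin2011, Thm. 2.36] -/
theorem eHomBesovNorm_top_coe_le_eBesovSupSeminorm {s : ℝ} {p : ℝ≥0∞} [Fact (1 ≤ p)] (hp : p ≠ ⊤)
    (f : Lp F p (volume : Measure E)) :
    eHomBesovNorm s p ⊤ (f : 𝓢'(E, F)) ≤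
      blockDiffConst E s p * eBesovSupSeminorm s p (f : E → F) volume := by
  rw [eHomBesovNorm_top]
  refine iSup_le fun j => ?_
  calc (2 : ℝ≥0∞) ^ ((j : ℝ) * s) * eLpNormDistrib p (lpBlock j (f : 𝓢'(E, F)))
      ≤ (2 : ℝ≥0∞) ^ ((j : ℝ) * s) * (blockDiffConst E s p * (2 : ℝ≥0∞) ^ (-((j : ℝ) * s)) *
          eBesovSupSeminorm s p (f : E → F) volume) := by
        gcongr
        exact eLpNormDistrib_lpBlock_coe_le hp f j
    _ = blockDiffConst E s p * ((2 : ℝ≥0∞) ^ ((j : ℝ) * s) * (2 : ℝ≥0∞) ^ (-((j : ℝ) * s))) *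
          eBesovSupSeminorm s p (f : E → F) volume := by ring
    _ = blockDiffConst E s p * eBesovSupSeminorm s p (f : E → F) volume := by
        rw [two_rpow_mul_two_rpow, add_neg_cancel, ENNReal.rpow_zero, mul_one]

end BlockScaling

/-! ## The dyadic sum of the difference estimate -/

section DyadicSumDiff

/-- **The dyadic sum of the finite-difference characterisation.** For `0 < s < 1` there is
`K < ∞` with `∑_{j ∈ ℤ} min(2^j t, 1) (2^j t)^{-s} ≤ K` for every `t > 0`: with `2^{j₀} t ∈ [1/2, 1)`
the terms `j ≥ j₀` are `≤ 2^s 2^{-(j-j₀)s}` (use `min ≤ 1`) and the terms `j < j₀` are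
`≤ 2^{-(j₀-j)(1-s)}` (use `min ≤ 2^j t`); both tails are geometric (BCD, proof of Thm. 2.36:
"`∑_{2^j|y| ≤ 1} 2^{j(1-s)} |y| + ∑_{2^j |y| > 1} 2^{-js} ≲ |y|^s`"). [folklore] -/
theorem exists_tsum_min_mul_rpow_neg_le {s : ℝ} (hs0 : 0 < s) (hs1 : s < 1) :
    ∃ K : ℝ≥0∞, K ≠ ⊤ ∧ ∀ t : ℝ, 0 < t →
      ∑' j : ℤ, ENNReal.ofReal (min ((2 : ℝ) ^ j * t) 1 * ((2 : ℝ) ^ j * t) ^ (-s)) ≤ K := by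
  -- the function and its two bounds
  set h : ℝ → ℝ := fun x => min x 1 * x ^ (-s) with hh
  have hb1 : ∀ x, 0 < x → h x ≤ x ^ (1 - s) := fun x hx => by
    calc h x = min x 1 * x ^ (-s) := rfl
      _ ≤ x * x ^ (-s) := mul_le_mul_of_nonneg_right (min_le_left _ _) (Real.rpow_nonneg hx.le _)
      _ = x ^ (1 - s) := by
          rw [sub_eq_add_neg, Real.rpow_add hx, Real.rpow_one]
  have hb2 : ∀ x, 0 < x → h x ≤ x ^ (-s) := fun x hx => by
    calc h x = min x 1 * x ^ (-s) := rfl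
      _ ≤ 1 * x ^ (-s) := mul_le_mul_of_nonneg_right (min_le_right _ _) (Real.rpow_nonneg hx.le _)
      _ = x ^ (-s) := one_mul _
  set ρ₁ : ℝ≥0∞ := ENNReal.ofReal ((2 : ℝ) ^ (-s)) with hρ₁
  have hρ₁1 : ρ₁ < 1 := by
    rw [hρ₁, ENNReal.ofReal_lt_one]
    exact Real.rpow_lt_one_of_one_lt_of_neg one_lt_two (neg_neg_of_pos hs0)
  set ρ₂ : ℝ≥0∞ := ENNReal.ofReal ((2 : ℝ) ^ (-(1 - s))) with hρ₂
  have hρ₂1 : ρ₂ < 1 := by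
    rw [hρ₂, ENNReal.ofReal_lt_one]
    exact Real.rpow_lt_one_of_one_lt_of_neg one_lt_two (neg_neg_of_pos (sub_pos.2 hs1))
  set A : ℝ≥0∞ := ENNReal.ofReal ((2 : ℝ) ^ s) with hA
  refine ⟨A * (1 - ρ₁)⁻¹ + (1 - ρ₂)⁻¹, ?_, fun t ht => ?_⟩
  · have h1 : (1 - ρ₁)⁻¹ ≠ ⊤ := ENNReal.inv_ne_top.2 (tsub_pos_of_lt hρ₁1).ne'
    have h2 : (1 - ρ₂)⁻¹ ≠ ⊤ := ENNReal.inv_ne_top.2 (tsub_pos_of_lt hρ₂1).ne'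
    exact ENNReal.add_ne_top.2 ⟨ENNReal.mul_ne_top ENNReal.ofReal_ne_top h1, h2⟩
  -- choose `j₀` with `2^{j₀} t ∈ [1/2, 1)`
  obtain ⟨m, hm⟩ := exists_mem_Ico_zpow ht one_lt_two
  set j₀ : ℤ := -m - 1 with hj₀
  set x₀ : ℝ := (2 : ℝ) ^ j₀ * t with hx₀
  have hx₀1 : x₀ < 1 := by
    have := hm.2
    rw [hx₀, hj₀, show -m - 1 = -(m + 1) by ring, zpow_neg, inv_mul_lt_iff₀ (zpow_pos two_pos _)]
    simpa using this
  have hx₀2 : 2⁻¹ ≤ x₀ := by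
    have := hm.1
    rw [hx₀, hj₀, show -m - 1 = -(m + 1) by ring, zpow_neg, le_inv_mul_iff₀ (zpow_pos two_pos _),
      zpow_add_one₀ (two_ne_zero' ℝ)]
    linarith
  have hx₀0 : 0 < x₀ := lt_of_lt_of_le (by norm_num) hx₀2
  -- reindex `j = k + j₀`
  have hshift : ∑' j : ℤ, ENNReal.ofReal (h ((2 : ℝ) ^ j * t)) =
      ∑' k : ℤ, ENNReal.ofReal (h ((2 : ℝ) ^ k * x₀)) := by
    rw [← (Equiv.addRight j₀).tsum_eq]
    congr 1
    funext k
    simp only [Equiv.coe_addRight, hx₀]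
    rw [zpow_add₀ (two_ne_zero' ℝ), mul_assoc]
  -- bounds on the two tails
  have hpos : ∀ k : ℕ, ENNReal.ofReal (h ((2 : ℝ) ^ (k : ℤ) * x₀)) ≤ A * ρ₁ ^ k := by
    intro k
    have hx : 0 < (2 : ℝ) ^ (k : ℤ) * x₀ := by positivity
    rw [hA, hρ₁, ← ENNReal.ofReal_pow (Real.rpow_nonneg zero_le_two _),
      ← ENNReal.ofReal_mul (by positivity)]
    refine ENNReal.ofReal_le_ofReal ((hb2 _ hx).trans ?_)
    rw [← Real.rpow_natCast, ← Real.rpow_mul zero_le_two, zpow_natCast]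
    have hxlow : (2 : ℝ) ^ k * 2⁻¹ ≤ (2 : ℝ) ^ k * x₀ := by gcongr
    have hk2 : 0 < (2 : ℝ) ^ k * 2⁻¹ := by positivity
    calc ((2 : ℝ) ^ k * x₀) ^ (-s) ≤ ((2 : ℝ) ^ k * 2⁻¹) ^ (-s) :=
          Real.rpow_le_rpow_of_nonpos hk2 hxlow (neg_nonpos.2 hs0.le)
      _ = (2 : ℝ) ^ s * (2 : ℝ) ^ (-s * k) := by
          rw [Real.mul_rpow (by positivity) (by norm_num), Real.inv_rpow zero_le_two,
            ← Real.rpow_neg zero_le_two, neg_neg, ← Real.rpow_natCast, ← Real.rpow_mul zero_le_two]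
          ring_nf
  have hneg : ∀ k : ℕ, ENNReal.ofReal (h ((2 : ℝ) ^ (-((k : ℤ) + 1)) * x₀)) ≤ ρ₂ ^ k := by
    intro k
    have hx : 0 < (2 : ℝ) ^ (-((k : ℤ) + 1)) * x₀ := by positivity
    rw [hρ₂, ← ENNReal.ofReal_pow (Real.rpow_nonneg zero_le_two _)]
    refine ENNReal.ofReal_le_ofReal ((hb1 _ hx).trans ?_)
    rw [← Real.rpow_natCast, ← Real.rpow_mul zero_le_two]
    have hxle : (2 : ℝ) ^ (-((k : ℤ) + 1)) * x₀ ≤ (2 : ℝ) ^ (-((k : ℤ) + 1)) :=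
      mul_le_of_le_one_right (zpow_nonneg zero_le_two _) hx₀1.le
    have h1s : 0 ≤ 1 - s := (sub_pos.2 hs1).le
    calc ((2 : ℝ) ^ (-((k : ℤ) + 1)) * x₀) ^ (1 - s) ≤ ((2 : ℝ) ^ (-((k : ℤ) + 1))) ^ (1 - s) :=
          Real.rpow_le_rpow hx.le hxle h1s
      _ = (2 : ℝ) ^ (-(1 - s) * (k + 1)) := by
          rw [← Real.rpow_intCast, ← Real.rpow_mul zero_le_two]
          push_cast
          ring_nf
      _ ≤ (2 : ℝ) ^ (-(1 - s) * k) := by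
          refine Real.rpow_le_rpow_of_exponent_le one_le_two ?_
          nlinarith
  -- sum the two geometric tails
  rw [show (fun j : ℤ => ENNReal.ofReal (min ((2 : ℝ) ^ j * t) 1 * ((2 : ℝ) ^ j * t) ^ (-s))) =
      fun j : ℤ => ENNReal.ofReal (h ((2 : ℝ) ^ j * t)) from rfl, hshift,
    tsum_of_nat_of_neg_add_one ENNReal.summable ENNReal.summable]
  gcongr
  · calc ∑' k : ℕ, ENNReal.ofReal (h ((2 : ℝ) ^ (k : ℤ) * x₀)) ≤ ∑' k : ℕ, A * ρ₁ ^ k :=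
          ENNReal.tsum_le_tsum hpos
      _ = A * (1 - ρ₁)⁻¹ := by rw [ENNReal.tsum_mul_left, ENNReal.tsum_geometric]
  · calc ∑' k : ℕ, ENNReal.ofReal (h ((2 : ℝ) ^ (-((k : ℤ) + 1)) * x₀)) ≤ ∑' k : ℕ, ρ₂ ^ k :=
          ENNReal.tsum_le_tsum hneg
      _ = (1 - ρ₂)⁻¹ := ENNReal.tsum_geometric ρ₂

end DyadicSumDiff

/-! ## The difference symbol `e_h - 1` on the dyadic annuli -/

section SymbolBounds

variable {E : Type*} [NormedAddCommGroup E] [InnerProductSpace ℝ E]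

/-- The rescaled translation symbol minus one is `(e - 1) ∘ L` with `e(t) = e^{2πit}` and the linear
form `L = 2^j ⟨h, ·⟩`. [folklore] -/
theorem translSymbol_rescaled_sub_one_eq_comp (h : E) (j : ℤ) :
    (fun ξ : E => translSymbol h (((2 : ℝ) ^ j) • ξ) - 1) =
      (fun t : ℝ => (𝐞 t : ℂ) - 1) ∘ ⇑(((2 : ℝ) ^ j) • innerSL ℝ h) := by
  funext ξ
  simp only [Function.comp_apply, FunLike.coe_smul, Pi.smul_apply, innerSL_apply_apply,
    smul_eq_mul, translSymbol_apply, real_inner_smul_left, real_inner_comm h ξ]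

/-- `‖2^j ⟨h, ·⟩‖ ≤ 2^j ‖h‖`. [folklore] -/
theorem norm_two_zpow_smul_innerSL_le (h : E) (j : ℤ) :
    ‖((2 : ℝ) ^ j) • innerSL ℝ h‖ ≤ (2 : ℝ) ^ j * ‖h‖ := by
  rw [norm_smul, Real.norm_of_nonneg (zpow_nonneg zero_le_two _), innerSL_apply_norm]

/-- Derivatives of `t ↦ e^{2πit} - 1`: order `0` is `≤ 2π|t|`, order `N ≥ 1` has norm `(2π)^N`.
[folklore] -/
theorem norm_iteratedFDeriv_fourierChar_sub_one_le (N : ℕ) (t : ℝ) :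
    ‖iteratedFDeriv ℝ N (fun t : ℝ => (𝐞 t : ℂ) - 1) t‖ ≤
      if N = 0 then 2 * π * |t| else (2 * π) ^ N := by
  split_ifs with hN
  · subst hN
    rw [norm_iteratedFDeriv_zero, Real.fourierChar_apply, mul_comm _ I]
    refine (Real.norm_exp_I_mul_ofReal_sub_one_le).trans ?_
    rw [Real.norm_eq_abs, abs_mul, abs_of_pos Real.two_pi_pos]
  · have hsub : (fun t : ℝ => (𝐞 t : ℂ) - 1) = (fun t : ℝ => (𝐞 t : ℂ)) - fun _ => (1 : ℂ) := rfl
    rw [hsub, iteratedFDeriv_sub_apply ((contDiff_fourierChar_coe.of_le (mod_cast le_top)).contDiffAt)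
      contDiffAt_const, iteratedFDeriv_const_of_ne hN, Pi.zero_apply, sub_zero,
      norm_iteratedFDeriv_fourierChar_coe]

/-- **Derivatives of the rescaled difference symbol on the annulus.** If `2π 2^j ‖h‖ ≤ 1`, then for
every order `N` and every `‖x‖ ≤ 4`,
`‖D^N (ξ ↦ e^{2πi⟨2^j ξ, h⟩} - 1)(x)‖ ≤ 4 · (2π 2^j ‖h‖)`
(order `0`: `|e^{iθ} - 1| ≤ |θ| ≤ 2π 2^j ‖h‖ ‖x‖`; order `N ≥ 1`: `(2π 2^j ‖h‖)^N ≤ 2π 2^j ‖h‖`).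
[folklore] -/
theorem norm_iteratedFDeriv_translSymbol_rescaled_sub_one_le (h : E) (j : ℤ)
    (ha : 2 * π * ((2 : ℝ) ^ j * ‖h‖) ≤ 1) (N : ℕ) {x : E} (hx : ‖x‖ ≤ 4) :
    ‖iteratedFDeriv ℝ N (fun ξ : E => translSymbol h (((2 : ℝ) ^ j) • ξ) - 1) x‖ ≤
      4 * (2 * π * ((2 : ℝ) ^ j * ‖h‖)) := by
  set a : ℝ := 2 * π * ((2 : ℝ) ^ j * ‖h‖) with ha_def
  have ha0 : 0 ≤ a := by positivity
  set L : E →L[ℝ] ℝ := ((2 : ℝ) ^ j) • innerSL ℝ h with hL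
  have hLn : ‖L‖ ≤ (2 : ℝ) ^ j * ‖h‖ := norm_two_zpow_smul_innerSL_le h j
  have hL2 : 2 * π * ‖L‖ ≤ a := by rw [ha_def]; gcongr
  have hφ : ContDiff ℝ ∞ (fun t : ℝ => (𝐞 t : ℂ) - 1) := contDiff_fourierChar_coe.sub contDiff_const
  rw [translSymbol_rescaled_sub_one_eq_comp, L.iteratedFDeriv_comp_right hφ x (mod_cast le_top)]
  refine (ContinuousMultilinearMap.norm_compContinuousLinearMap_le _ _).trans ?_
  rw [Finset.prod_const, Finset.card_univ, Fintype.card_fin]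
  refine (mul_le_mul_of_nonneg_right (norm_iteratedFDeriv_fourierChar_sub_one_le N (L x))
    (by positivity)).trans ?_
  split_ifs with hN
  · subst hN
    rw [pow_zero, mul_one]
    calc 2 * π * |L x| ≤ 2 * π * (‖L‖ * ‖x‖) := by
          gcongr
          exact (Real.norm_eq_abs _ ▸ L.le_opNorm x)
      _ = (2 * π * ‖L‖) * ‖x‖ := by ring
      _ ≤ a * 4 := mul_le_mul hL2 hx (norm_nonneg _) ha0
      _ = 4 * a := mul_comm _ _
  · have hN1 : 1 ≤ N := Nat.one_le_iff_ne_zero.2 hN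
    calc (2 * π) ^ N * ‖L‖ ^ N = (2 * π * ‖L‖) ^ N := by rw [mul_pow (2 * π)]
      _ ≤ a ^ N := pow_le_pow_left₀ (by positivity) hL2 N
      _ ≤ a ^ 1 := pow_le_pow_of_le_one ha0 ha hN1
      _ = a := pow_one a
      _ ≤ 4 * a := by linarith

end SymbolBounds

/-! ## `‖τ_h f - f‖_{L^p} ≲ ‖h‖^s ‖f‖_{Ḃ^s_{p,∞}}`: the Littlewood–Paley side controls differences -/

section DifferenceFromBlocks

variable {E : Type*} [NormedAddCommGroup E] [InnerProductSpace ℝ E] [FiniteDimensional ℝ E]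
  [MeasurableSpace E] [BorelSpace E] {F : Type*} [NormedAddCommGroup F] [NormedSpace ℂ F]
  [CompleteSpace F]

omit [FiniteDimensional ℝ E] [MeasurableSpace E] [BorelSpace E] in
/-- The difference symbol `e_h - 1` has temperate growth. [folklore] -/
theorem hasTemperateGrowth_translSymbol_sub_one (h : E) :
    (fun ξ : E => translSymbol h ξ - 1).HasTemperateGrowth :=
  (hasTemperateGrowth_translSymbol h).sub (Function.HasTemperateGrowth.const 1)

omit [CompleteSpace F] in
/-- `(e_h - 1)(D)` commutes with the cut-offs `Ṡ_j` (both are Fourier multipliers). [folklore] -/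
theorem lowFreqCutoff_translSymbol_sub_one_comm (h : E) (j : ℤ) (u : 𝓢'(E, F)) :
    lowFreqCutoff j (fourierMultiplierCLM F (fun ξ : E => translSymbol h ξ - 1) u) =
      fourierMultiplierCLM F (fun ξ : E => translSymbol h ξ - 1) (lowFreqCutoff j u) := by
  rw [lowFreqCutoff_apply, lowFreqCutoff_apply,
    TemperedDistribution.fourierMultiplierCLM_fourierMultiplierCLM_apply
      (hasTemperateGrowth_translSymbol_sub_one h) (hasTemperateGrowth_lowFreqSymbol j),
    TemperedDistribution.fourierMultiplierCLM_fourierMultiplierCLM_apply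
      (hasTemperateGrowth_lowFreqSymbol j) (hasTemperateGrowth_translSymbol_sub_one h), mul_comm]

omit [CompleteSpace F] in
/-- `(e_h - 1)(D)` commutes with the blocks `Δ̇_j`. [folklore] -/
theorem lpBlock_translSymbol_sub_one_comm (h : E) (j : ℤ) (u : 𝓢'(E, F)) :
    lpBlock j (fourierMultiplierCLM F (fun ξ : E => translSymbol h ξ - 1) u) =
      fourierMultiplierCLM F (fun ξ : E => translSymbol h ξ - 1) (lpBlock j u) := by
  rw [lpBlock_apply, lpBlock_apply,
    TemperedDistribution.fourierMultiplierCLM_fourierMultiplierCLM_apply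
      (hasTemperateGrowth_translSymbol_sub_one h) (hasTemperateGrowth_dyadicSymbol j),
    TemperedDistribution.fourierMultiplierCLM_fourierMultiplierCLM_apply
      (hasTemperateGrowth_dyadicSymbol j) (hasTemperateGrowth_translSymbol_sub_one h), mul_comm]

/-- **High frequencies**: `‖(e_h - 1)(D) w‖_{L^p} ≤ 2 ‖w‖_{L^p}` for every tempered distribution
(`τ_h` is an `L^p` isometry). [folklore] -/
theorem eLpNormDistrib_translSymbol_sub_one_le_two_mul {p : ℝ≥0∞} [Fact (1 ≤ p)] (h : E)
    (w : 𝓢'(E, F)) :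
    eLpNormDistrib p (fourierMultiplierCLM F (fun ξ : E => translSymbol h ξ - 1) w) ≤
      2 * eLpNormDistrib p w := by
  have h1 : (fun ξ : E => translSymbol h ξ - 1) = translSymbol h - fun _ => (1 : ℂ) := rfl
  rw [h1, fourierMultiplierCLM_sub (hasTemperateGrowth_translSymbol h)
    (Function.HasTemperateGrowth.const 1), sub_apply, TemperedDistribution.fourierMultiplierCLM_const,
    one_smul, ContinuousLinearMap.id_apply, two_mul]
  exact (eLpNormDistrib_sub_le _ _).trans
    (add_le_add (eLpNormDistrib_fourierMultiplierCLM_translSymbol_le h w) le_rfl)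

/-- **Low frequencies** (Bernstein through the multiplier lemma, BCD Lemma 2.2 form): there is
`C` with `‖(e_h - 1)(D) Δ̇_j u‖_{L^p} ≤ C (2π 2^j ‖h‖) ‖Δ̇_j u‖_{L^p}` whenever `2π 2^j ‖h‖ ≤ 1`
(BCD, proof of Thm. 2.36: "`‖τ_{-y} Δ̇_j u - Δ̇_j u‖_{L^p} ≤ C|y| ‖∇Δ̇_j u‖_{L^p}` and Bernstein").
[cite: BahouriCheminDanchin2011, Thm. 2.36] -/
theorem exists_eLpNormDistrib_translSymbol_sub_one_lpBlock_le (p : ℝ≥0∞) [Fact (1 ≤ p)] :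
    ∃ C : ℝ≥0, ∀ (h : E) (j : ℤ), 2 * π * ((2 : ℝ) ^ j * ‖h‖) ≤ 1 → ∀ u : 𝓢'(E, F),
      eLpNormDistrib p (fourierMultiplierCLM F (fun ξ : E => translSymbol h ξ - 1) (lpBlock j u)) ≤
        C * ENNReal.ofReal (2 * π * ((2 : ℝ) ^ j * ‖h‖)) * eLpNormDistrib p (lpBlock j u) := by
  obtain ⟨n, C, hC⟩ := exists_eLpNormDistrib_fourierMultiplierCLM_lpBlock_le (E := E) (F := F) p
  refine ⟨C * 4, fun h j ha u => ?_⟩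
  have hB : ∀ N ≤ n, ∀ x ∈ blockAnnulus E,
      ‖iteratedFDeriv ℝ N (fun ξ : E => (fun ξ : E => translSymbol h ξ - 1) (((2 : ℝ) ^ j) • ξ)) x‖ ≤
        4 * (2 * π * ((2 : ℝ) ^ j * ‖h‖)) := fun N _ x hx =>
    norm_iteratedFDeriv_translSymbol_rescaled_sub_one_le h j ha N hx.2
  have hmain := hC _ (hasTemperateGrowth_translSymbol_sub_one h) j _ (by positivity) hB u
  calc eLpNormDistrib p (fourierMultiplierCLM F (fun ξ : E => translSymbol h ξ - 1) (lpBlock j u))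
      ≤ C * ENNReal.ofReal (4 * (2 * π * ((2 : ℝ) ^ j * ‖h‖))) * eLpNormDistrib p (lpBlock j u) := hmain
    _ = ((C * 4 : ℝ≥0) : ℝ≥0∞) * ENNReal.ofReal (2 * π * ((2 : ℝ) ^ j * ‖h‖)) *
          eLpNormDistrib p (lpBlock j u) := by
        rw [ENNReal.ofReal_mul (by norm_num), ENNReal.ofReal_ofNat, ENNReal.coe_mul]
        push_cast
        ring

/-- `(2^j)^{-s} = t^s (2^j t)^{-s}` for `t > 0`. [folklore] -/
theorem two_zpow_rpow_neg_eq (j : ℤ) (s : ℝ) {t : ℝ} (ht : 0 < t) :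
    ((2 : ℝ) ^ j) ^ (-s) = t ^ s * ((2 : ℝ) ^ j * t) ^ (-s) := by
  rw [Real.mul_rpow (zpow_nonneg zero_le_two _) ht.le, mul_left_comm, Real.rpow_neg ht.le,
    mul_inv_cancel₀ (Real.rpow_pos_of_pos ht s).ne', mul_one]

/-- **`sup_h ‖τ_h f - f‖_{L^p} / ‖h‖^s ≲ ‖f‖_{Ḃ^s_{p,∞}}` for `f ∈ L^p ∩ 𝓢'_h`, `0 < s < 1`**
(BCD Thm. 2.36, second inequality, `r = ∞`): for `1 ≤ p ≤ ∞` there is `C < ∞` such that for every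
`f ∈ L^p(E; F)` with `Ṡ_j f → 0` (`j → -∞`),
`[f]_{B^s_{p,∞}} ≤ C ‖f‖_{Ḃ^s_{p,∞}}`. Proof: `τ_h f - f = (e_h - 1)(D) f ∈ 𝓢'_h`, so
`‖τ_h f - f‖_{L^p} ≤ ∑_j ‖(e_h - 1)(D) Δ̇_j f‖_{L^p} ≤ ∑_j min(C 2^j‖h‖, 2) 2^{-js} ‖f‖_{Ḃ^s_{p,∞}}
≲ ‖h‖^s ‖f‖_{Ḃ^s_{p,∞}}`. [cite: BahouriCheminDanchin2011, Thm. 2.36] -/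
theorem exists_eBesovSupSeminorm_coe_le_eHomBesovNorm {s : ℝ} (hs0 : 0 < s) (hs1 : s < 1)
    (p : ℝ≥0∞) [Fact (1 ≤ p)] :
    ∃ C : ℝ≥0∞, C ≠ ⊤ ∧ ∀ f : Lp F p (volume : Measure E),
      Tendsto (fun j : ℤ => lowFreqCutoff j (f : 𝓢'(E, F))) atBot (𝓝 0) →
      eBesovSupSeminorm s p (f : E → F) volume ≤ C * eHomBesovNorm s p ⊤ (f : 𝓢'(E, F)) := by
  obtain ⟨C, hC⟩ := exists_eLpNormDistrib_translSymbol_sub_one_lpBlock_le (E := E) (F := F) p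
  obtain ⟨K, hKtop, hK⟩ := exists_tsum_min_mul_rpow_neg_le hs0 hs1
  set C' : ℝ≥0∞ := max (C : ℝ≥0∞) 2 with hC'
  have hC'top : C' ≠ ⊤ := by simp [hC']
  refine ⟨C' * K * ENNReal.ofReal ((2 * π) ^ s), ?_, fun f hreal => ?_⟩
  · exact ENNReal.mul_ne_top (ENNReal.mul_ne_top hC'top hKtop) ENNReal.ofReal_ne_top
  set N : ℝ≥0∞ := eHomBesovNorm s p ⊤ (f : 𝓢'(E, F)) with hN
  refine iSup₂_le fun h hh => ?_
  set t : ℝ := 2 * π * ‖h‖ with ht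
  have htpos : 0 < t := by rw [ht]; exact mul_pos Real.two_pi_pos (norm_pos_iff.2 hh)
  -- the difference as a distribution in `𝓢'_h`
  set u : 𝓢'(E, F) := fourierMultiplierCLM F (fun ξ : E => translSymbol h ξ - 1) (f : 𝓢'(E, F)) with hu
  have hrealu : Tendsto (fun j : ℤ => lowFreqCutoff j u) atBot (𝓝 0) := by
    simp_rw [hu, lowFreqCutoff_translSymbol_sub_one_comm]
    have hc := ((fourierMultiplierCLM F (fun ξ : E => translSymbol h ξ - 1) :
      𝓢'(E, F) →L[ℂ] 𝓢'(E, F)).continuous.tendsto 0).comp hreal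
    rwa [map_zero] at hc
  -- blockwise bounds
  have hblock : ∀ j : ℤ, eLpNormDistrib p (lpBlock j (f : 𝓢'(E, F))) ≤
      (2 : ℝ≥0∞) ^ ((j : ℝ) * (-s)) * N := by
    intro j
    have := eLpNormDistrib_lpBlock_le_two_rpow_mul_eHomBesovNorm_neg (p := p) (-s) (f : 𝓢'(E, F)) j
    rwa [neg_neg] at this
  have hterm : ∀ j : ℤ, eLpNormDistrib p (lpBlock j u) ≤
      C' * N * ENNReal.ofReal (t ^ s) *
        ENNReal.ofReal (min ((2 : ℝ) ^ j * t) 1 * ((2 : ℝ) ^ j * t) ^ (-s)) := by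
    intro j
    rw [hu, lpBlock_translSymbol_sub_one_comm]
    -- `min(C 2^j t, 2)`-bound
    have hmin : eLpNormDistrib p (fourierMultiplierCLM F (fun ξ : E => translSymbol h ξ - 1)
        (lpBlock j (f : 𝓢'(E, F)))) ≤
        C' * ENNReal.ofReal (min ((2 : ℝ) ^ j * t) 1) * eLpNormDistrib p (lpBlock j (f : 𝓢'(E, F))) := by
      rcases le_or_gt ((2 : ℝ) ^ j * t) 1 with hjt | hjt
      · rw [min_eq_left hjt]
        have ha : 2 * π * ((2 : ℝ) ^ j * ‖h‖) ≤ 1 := by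
          rwa [show 2 * π * ((2 : ℝ) ^ j * ‖h‖) = (2 : ℝ) ^ j * t by rw [ht]; ring]
        calc _ ≤ C * ENNReal.ofReal (2 * π * ((2 : ℝ) ^ j * ‖h‖)) *
              eLpNormDistrib p (lpBlock j (f : 𝓢'(E, F))) := hC h j ha _
          _ ≤ C' * ENNReal.ofReal ((2 : ℝ) ^ j * t) * eLpNormDistrib p (lpBlock j (f : 𝓢'(E, F))) := by
              rw [show 2 * π * ((2 : ℝ) ^ j * ‖h‖) = (2 : ℝ) ^ j * t by rw [ht]; ring]
              gcongr
              exact le_max_left _ _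
      · rw [min_eq_right hjt.le, ENNReal.ofReal_one, mul_one]
        calc _ ≤ 2 * eLpNormDistrib p (lpBlock j (f : 𝓢'(E, F))) :=
              eLpNormDistrib_translSymbol_sub_one_le_two_mul h _
          _ ≤ C' * eLpNormDistrib p (lpBlock j (f : 𝓢'(E, F))) := by
              gcongr
              exact le_max_right _ _
    refine hmin.trans ?_
    have h2 : (2 : ℝ≥0∞) ^ ((j : ℝ) * (-s)) =
        ENNReal.ofReal (t ^ s) * ENNReal.ofReal (((2 : ℝ) ^ j * t) ^ (-s)) := by
      rw [← ofReal_two_zpow_rpow, two_zpow_rpow_neg_eq j s htpos, ENNReal.ofReal_mul (by positivity)]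
    calc C' * ENNReal.ofReal (min ((2 : ℝ) ^ j * t) 1) * eLpNormDistrib p (lpBlock j (f : 𝓢'(E, F)))
        ≤ C' * ENNReal.ofReal (min ((2 : ℝ) ^ j * t) 1) * ((2 : ℝ≥0∞) ^ ((j : ℝ) * (-s)) * N) := by
          gcongr
          exact hblock j
      _ = C' * N * ENNReal.ofReal (t ^ s) *
          (ENNReal.ofReal (min ((2 : ℝ) ^ j * t) 1) * ENNReal.ofReal (((2 : ℝ) ^ j * t) ^ (-s))) := by
          rw [h2]; ring
      _ = C' * N * ENNReal.ofReal (t ^ s) *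
          ENNReal.ofReal (min ((2 : ℝ) ^ j * t) 1 * ((2 : ℝ) ^ j * t) ^ (-s)) := by
          rw [← ENNReal.ofReal_mul (le_min (by positivity) zero_le_one)]
  -- summation
  have hsum : eLpNormDistrib p u ≤ C' * N * ENNReal.ofReal (t ^ s) * K :=
    calc eLpNormDistrib p u ≤ ∑' j : ℤ, eLpNormDistrib p (lpBlock j u) :=
          eLpNormDistrib_le_tsum_lpBlock u hrealu
      _ ≤ ∑' j : ℤ, C' * N * ENNReal.ofReal (t ^ s) *
          ENNReal.ofReal (min ((2 : ℝ) ^ j * t) 1 * ((2 : ℝ) ^ j * t) ^ (-s)) :=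
        ENNReal.tsum_le_tsum hterm
      _ ≤ C' * N * ENNReal.ofReal (t ^ s) * K := by
          rw [ENNReal.tsum_mul_left]
          gcongr
          exact hK t htpos
  -- the difference quotient
  have hdiff :
      eLpNorm (fun x => (f : E → F) (x + h) - (f : E → F) x) p volume = eLpNormDistrib p u := by
    rw [hu, fourierMultiplierCLM_translSymbol_sub_one_coe, eLpNormDistrib_coe, enorm_lpTranslate_sub]
  rw [eDiffQuotient_def, hdiff]
  refine ENNReal.div_le_of_le_mul (hsum.trans (le_of_eq ?_))
  rw [ht, Real.mul_rpow Real.two_pi_pos.le (norm_nonneg _), ENNReal.ofReal_mul (by positivity)]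
  ring

end DifferenceFromBlocks

/-! ## The characterisation `Ḃ^s_{p,∞} ∩ L^p = B^s_{p,∞}` (difference form), `0 < s < 1` -/

section Characterisation

variable {E : Type*} [NormedAddCommGroup E] [InnerProductSpace ℝ E] [FiniteDimensional ℝ E]
  [MeasurableSpace E] [BorelSpace E] {F : Type*} [NormedAddCommGroup F] [NormedSpace ℂ F]
  [CompleteSpace F]

/-- **Differences ⇒ Littlewood–Paley** (BCD Thm. 2.36, first inequality, with `L^p ⊂ 𝓢'_h` for
finite `p`): an `L^p` function (`1 ≤ p < ∞`, `dim E ≥ 1`) with finite difference seminorm of order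
`s ≥ 0` lies in `Ḃ^s_{p,∞}`. [cite: BahouriCheminDanchin2011, Thm. 2.36] -/
theorem memHomBesov_top_coe_of_memBesovSup [Nontrivial E] {s : ℝ} (hs : 0 ≤ s) {p : ℝ≥0∞}
    [Fact (1 ≤ p)] (hp : p ≠ ⊤) (f : Lp F p (volume : Measure E))
    (hf : MemBesovSup s p (f : E → F) volume) : MemHomBesov s p ⊤ (f : 𝓢'(E, F)) :=
  ⟨(eHomBesovNorm_top_coe_le_eBesovSupSeminorm hp f).trans_lt
    (ENNReal.mul_lt_top (blockDiffConst_lt_top hs hp) hf.2), tendsto_lowFreqCutoff_coe_atBot hp f⟩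

/-- **Littlewood–Paley ⇒ differences** (BCD Thm. 2.36, second inequality): an `L^p` function
(`1 ≤ p ≤ ∞`) in `Ḃ^s_{p,∞}`, `0 < s < 1`, has finite difference seminorm of order `s`.
[cite: BahouriCheminDanchin2011, Thm. 2.36] -/
theorem memBesovSup_coe_of_memHomBesov_top {s : ℝ} (hs₀ : 0 < s) (hs₁ : s < 1) {p : ℝ≥0∞}
    [Fact (1 ≤ p)] (f : Lp F p (volume : Measure E)) (hf : MemHomBesov s p ⊤ (f : 𝓢'(E, F))) :
    MemBesovSup s p (f : E → F) volume := by
  obtain ⟨C, hCtop, hC⟩ := exists_eBesovSupSeminorm_coe_le_eHomBesovNorm (E := E) (F := F) hs₀ hs₁ p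
  exact ⟨Lp.memLp f, (hC f hf.2).trans_lt (ENNReal.mul_lt_top hCtop.lt_top hf.1)⟩

/-- **Discharge of the named fact `memHomBesov_iff_memBesovSup` at every `E` of positive
dimension** (BCD Thm. 2.36 with `r = ∞`, `0 < s < 1`, together with `L^p ⊂ 𝓢'_h` for finite `p`):
for `f ∈ L^p(E; F)`, `1 ≤ p < ∞`, `f ∈ Ḃ^s_{p,∞}` (finite Littlewood–Paley norm and `Ṡ_j f → 0`)
iff `sup_{h ≠ 0} ‖f(· + h) - f‖_{L^p} / ‖h‖^s < ∞`. The named fact is a `Prop` family indexed by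
the implicit `E`, `F`; the source is on `ℝ^d`, `d ≥ 1`, and at `E = {0}` the family is **false**
(`not_memHomBesov_iff_memBesovSup`: there `Ṡ_j = id`, so no nonzero `L^p` function satisfies the
realisation condition, while every difference seminorm vanishes). This theorem therefore carries
the hypothesis `[Nontrivial E]` as a section instance; the closed corrected fact is
`memHomBesov_iff_memBesovSup_of_nontrivial`. Cross-reference (held): Triebel 1983, §5.2.3,
Theorem 2, eq. (7) with `M = 1`, `q = ∞` (difference norms on `Ḃ^s_{p,q}`, `1 ≤ p, q ≤ ∞`, `s > 0`).
[cite: BahouriCheminDanchin2011, Thm. 2.36] -/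
theorem memHomBesov_iff_memBesovSup_holds [Nontrivial E] :
    memHomBesov_iff_memBesovSup (E := E) (F := F) := by
  intro s hs₀ hs₁ p _ hp f
  exact ⟨memBesovSup_coe_of_memHomBesov_top hs₀ hs₁ f, memHomBesov_top_coe_of_memBesovSup hs₀.le hp f⟩

/-- **Corrected form of the named fact `memHomBesov_iff_memBesovSup`** (finite-difference
characterisation of `Ḃ^s_{p,∞}`, `0 < s < 1`, `1 ≤ p < ∞`; BCD Thm. 2.36): the same statement with
the standing hypothesis of the source, `dim E ≥ 1` (`ℝ^d`, `d ≥ 1`), restored as the leading binder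
`∀ [Nontrivial E]`. The original `def` quantifies (through its implicit `E`) also over `E = {0}`,
where it fails (`not_memHomBesov_iff_memBesovSup`). Proved:
`memHomBesov_iff_memBesovSup_of_nontrivial_holds`. [cite: BahouriCheminDanchin2011, Thm. 2.36] -/
def memHomBesov_iff_memBesovSup_of_nontrivial : Prop :=
  ∀ [Nontrivial E] {s : ℝ} (_ : 0 < s) (_ : s < 1) {p : ℝ≥0∞} [Fact (1 ≤ p)] (_ : p ≠ (⊤ : ℝ≥0∞))
    (f : Lp F p (volume : Measure E)),
    MemHomBesov s p ⊤ (f : 𝓢'(E, F)) ↔ MemBesovSup s p (f : E → F) volume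

/-- Discharge of the corrected fact `memHomBesov_iff_memBesovSup_of_nontrivial`.
[cite: BahouriCheminDanchin2011, Thm. 2.36] -/
theorem memHomBesov_iff_memBesovSup_of_nontrivial_holds :
    memHomBesov_iff_memBesovSup_of_nontrivial (E := E) (F := F) := by
  intro _ s hs₀ hs₁ p _ hp f
  exact memHomBesov_iff_memBesovSup_holds hs₀ hs₁ hp f

end Characterisation

/-! ## The counterexample in dimension `0` -/

section DimensionZero

variable {E : Type*} [NormedAddCommGroup E] [InnerProductSpace ℝ E] [FiniteDimensional ℝ E]
  [MeasurableSpace E] [BorelSpace E] {F : Type*} [NormedAddCommGroup F] [NormedSpace ℂ F]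

omit [FiniteDimensional ℝ E] [MeasurableSpace E] [BorelSpace E] in
/-- On `E = {0}` every low-frequency symbol is the constant `χ(0) = 1`. [folklore] -/
theorem lowFreqSymbol_eq_one_of_subsingleton [Subsingleton E] (j : ℤ) :
    (lowFreqSymbol (E := E) j) = fun _ => (1 : ℂ) := by
  funext ξ
  rw [Subsingleton.elim ξ 0]
  simp [lowFreqSymbol, dyadicCutoff_apply_of_norm_le_one]

/-- On `E = {0}` the cut-offs `Ṡ_j` are the identity of `𝓢'(E, F)`. [folklore] -/
theorem lowFreqCutoff_eq_self_of_subsingleton [Subsingleton E] (j : ℤ) (u : 𝓢'(E, F)) :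
    lowFreqCutoff j u = u := by
  rw [lowFreqCutoff_apply, lowFreqSymbol_eq_one_of_subsingleton,
    TemperedDistribution.fourierMultiplierCLM_const, one_smul, ContinuousLinearMap.id_apply]

variable [CompleteSpace F]

/-- **The unguarded named fact `memHomBesov_iff_memBesovSup` is false in dimension `0`.** On
`E = {0}` (with `F ≠ {0}`): Lebesgue measure is the unit point mass, a nonzero constant `c` is a
nonzero element of `L¹`, its difference seminorm is `0` (there is no increment `h ≠ 0`), so the
right-hand side holds; but `Ṡ_j c = c ↛ 0`, so the realisation condition of `MemHomBesov` fails.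
[folklore] -/
theorem not_memHomBesov_iff_memBesovSup [Subsingleton E] [Nontrivial F] :
    ¬ memHomBesov_iff_memBesovSup (E := E) (F := F) := by
  intro hfact
  obtain ⟨c, hc⟩ := exists_ne (0 : F)
  haveI : Fact ((1 : ℝ≥0∞) ≤ 1) := ⟨le_rfl⟩
  have huniv : (volume : Measure E) Set.univ < ⊤ := by
    have : (Set.univ : Set E) = {0} := by
      ext x; simp [Subsingleton.elim x 0]
    rw [this]
    exact (measure_singleton_lt_top (μ := (volume : Measure E)) (a := (0 : E)))
  haveI : IsFiniteMeasure (volume : Measure E) := ⟨huniv⟩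
  set f : Lp F 1 (volume : Measure E) := (memLp_const c).toLp (fun _ : E => c) with hf
  have hsemi : eBesovSupSeminorm (1 / 2) 1 (f : E → F) volume = 0 := by
    refine le_antisymm (iSup₂_le fun h hh => ?_) bot_le
    exact absurd (Subsingleton.elim h 0) hh
  have hmem : MemBesovSup (1 / 2) 1 (f : E → F) volume :=
    ⟨Lp.memLp f, by rw [hsemi]; exact ENNReal.zero_lt_top⟩
  have hhom := (hfact (s := 1 / 2) (by norm_num) (by norm_num) (p := 1) ENNReal.one_ne_top f).2 hmem
  have hreal := hhom.2
  simp_rw [lowFreqCutoff_eq_self_of_subsingleton] at hreal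
  have hzero : (f : 𝓢'(E, F)) = 0 := tendsto_nhds_unique tendsto_const_nhds hreal
  have hf0 : f = 0 := by
    have hker := Lp.ker_toTemperedDistributionCLM_eq_bot (F := F) (μ := (volume : Measure E)) (p := 1)
    rw [LinearMap.ker_eq_bot] at hker
    apply hker
    rw [map_zero]
    exact hzero
  have hnorm : eLpNorm (fun _ : E => c) 1 (volume : Measure E) = 0 := by
    rw [← eLpNorm_congr_ae (MemLp.coeFn_toLp (memLp_const c)), ← hf, hf0]
    exact eLpNorm_congr_ae (Lp.coeFn_zero F 1 volume) |>.trans eLpNorm_zero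
  rw [eLpNorm_const c one_ne_zero (NeZero.ne volume)] at hnorm
  simp only [ENNReal.toReal_one, div_one, ENNReal.rpow_one, mul_eq_zero, enorm_eq_zero,
    Measure.measure_univ_eq_zero] at hnorm
  rcases hnorm with h | h
  · exact hc h
  · exact NeZero.ne volume h

/-- The concrete instance: the named fact fails for `E = ℝ⁰ = EuclideanSpace ℝ (Fin 0)` and
`F = ℂ`. [folklore] -/
theorem not_memHomBesov_iff_memBesovSup_euclideanSpace_fin_zero :
    ¬ memHomBesov_iff_memBesovSup (E := EuclideanSpace ℝ (Fin 0)) (F := ℂ) :=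
  not_memHomBesov_iff_memBesovSup

end DimensionZero

end Literature.Analysis.FunctionSpaces
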